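import Literature.Analysis.FluidPDE.TorusWeightedVorticityBalance
import Literature.Analysis.FluidPDE.TorusStrainVorticityIsometry
import Literature.Analysis.FluidPDE.TorusNSFoiasGuillopeTemam
import Literature.Analysis.FunctionSpaces.TorusClassicalNSGluing
import HarnessLib

/-!
# Constantin's direction-dissipation budget on `T³`, classical solutions, regularised form:
# `ν ∫₀ᵀ∫ |ω| |∇ξ|²_ε ≤ ‖(|ω₀|² + ε²)^{1/2}‖₁ + (2ν)⁻¹ ‖u₀‖₂²`

Analysis/FluidPDE proof file (theorems only; no definitions, no named facts).

Search for candidate a priori estimates; no regularity claim. Constantin 1990 (CMP 129, §2, periodic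
box): dividing the enstrophy-density balance (2.6) by `|ω|` gives the balance (2.7) for `|ω|`, in
which the term `ν|ω||∇ξ|²` (`ξ = ω/|ω|`, `|∇ω|² = |∇|ω||² + |ω|²|∇ξ|²`) is the **direction
dissipation**; integrating over space–time and using the energy dissipation (2.21) yields the
a priori budget `ν ∫₀ᵀ∫ |ω||∇ξ|² ≤ ‖ω₀‖_{L¹} + (2ν)⁻¹‖u₀‖²_{L²}` (Constantin 2003, Thm 2 for a
mollified system; the tree's NAMED FACT `constantin1990_direction_dissipation_bound` records it on
`ℝ³` for classical Leray–Hopf solutions, unproved — its proof needs decay at spatial infinity). Here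
the same mechanism is PROVED on the unit torus `T^d`, `card d = 3`, for CLASSICAL solutions of the
unforced equations, in REGULARISED form (every `ε > 0`), with the orientation-free objects of the
tree (`Q = |ω|² = torusVorticitySqAt`, the vorticity tensor `W`, `∑ₖᵢⱼ(∂ₖWᵢⱼ)² = 2|∇ω|²`,
`∑ₖ(∂ₖQ)² = |∇|ω|²|² = 4|ω|²|∇|ω||²`): the regularised direction-dissipation density is

`D_ε := ½ (Q + ε²)^{−1/2} ∑ₖᵢⱼ(∂ₖWᵢⱼ)² − ¼ (Q + ε²)^{−3/2} ∑ₖ(∂ₖQ)²`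
`     = (|∇ω|²(|ω|² + ε²) − |ω|²|∇|ω||²) / (|ω|² + ε²)^{3/2}`  (in `d = 3`)
`     ≥ |ω|⁴|∇ξ|² / (|ω|² + ε²)^{3/2} ≥ 0`, and `D_ε → |ω||∇ξ|²` where `ω ≠ 0` as `ε ↓ 0`,

i.e. exactly the viscous term of the weighted vorticity balance `d/dt ∫ (|ω|² + ε²)^{1/2}`
(Gibbon 2010 App. A / tree `IsClassicalNSSolutionOn.hasDerivWithinAt_integral_comp_torusVorticitySqAt`
with `Φ(y) = (y + ε²)^{1/2}`). The source term is `∫ σ (Q + ε²)^{−1/2}` with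
`|σ| = |ωᵀSω| ≤ |S|_F |ω|²`, hence `≤ ∫ |S|_F |ω| ≤ ½(∫|S|²_F + ∫|ω|²) = (3/2)ℰ = (3/4)‖∇u‖₂²`
(`∫|S|²_F = ℰ`, `∫|ω|² = 2ℰ` for divergence-free fields), and the energy budget
`∫₀ᵀ‖∇u‖₂² ≤ ‖u₀‖₂²/(2ν)` closes:

* `Torus.sum_sq_partialDeriv_torusVorticitySqAt_le` — `∑ₖ(∂ₖ|ω|²)² ≤ 2|ω|² ∑ₖᵢⱼ(∂ₖWᵢⱼ)²`
  (`|∇|ω|| ≤ |∇ω|`, Cauchy–Schwarz), whence `D_ε ≥ 0` (`Torus.directionDissipationReg_nonneg`).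
* `Torus.classicalNS_integral_directionDissipationReg_le` — **the regularised budget**: for
  `card d = 3`, every classical solution of the unforced Navier–Stokes equations (`ν > 0`) on
  `[0, T] × T^d`, `T > 0`, and every `ε > 0`,
  `ν ∫₀ᵀ ∫ D_ε(t, x) dx dt ≤ ∫ (|ω₀|² + ε²)^{1/2} dx + ‖u₀‖₂²/(2ν)`
  (the proof gives the factor `3/4` in front of `‖u₀‖₂²/(2ν)`; Constantin's display has `1`;
  `∫(|ω₀|²+ε²)^{1/2} ≤ ‖ω₀‖₁ + ε`). No mean-zero or decay hypothesis is needed on the torus.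
* `Torus.classicalNS_integral_vorticityAbs_le` — **the a priori `L¹` vorticity bound** (Constantin
  1990 Thm 2.1, first assertion): `∫|ω(t)| ≤ ∫|ω₀| + ‖u₀‖₂²/(2ν)` for every `t ∈ [0, T]`.
* `Torus.classicalNS_integral_weightedVorticityGradSq_le`, `Torus.classicalNS_integral_vorticityGradSq_rpow_le`
  — **Constantin 1990 Thm 2.1, second assertion** (`∇ω ∈ L^{4/(3+ε)}((0,T) × T³)` a priori):
  `(νε/4)∫₀ᵀ∫(1+|ω|²)^{−(1+ε)/2}∑(∂ₖWᵢⱼ)² ≤ M := 1 + 1/(2(1−ε)) + ∫|ω₀| + ‖u₀‖₂²/(2ν)` (weight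
  (2.16)–(2.17), balance (2.20)) and, by Hölder (2.22),
  `∫₀ᵀ∫(∑(∂ₖWᵢⱼ)²)^{2/(3+ε)} ≤ (4M/(νε))^{2/(3+ε)}(T + ‖u₀‖₂²/(2ν))^{(1+ε)/(3+ε)}`, `0 < ε < 1`
  (the printed range is `0 < ε ≤ ½`, p. 250: "for every `ε`, `0 < ε ≤ ½`, and `τ > 0`"; the Lean
  statements cover the strictly wider range `0 < ε < 1`, on which the same proof runs).
* `Torus.classicalNS_lintegral_directionDissipation_le` — **Constantin's budget** (`ε → 0` by
  Fatou): the density `D₀ = ½|ω|^{−1}∑ₖᵢⱼ(∂ₖWᵢⱼ)² − ¼|ω|^{−3}∑ₖ(∂ₖ|ω|²)²` (`= |ω||∇ξ|²` on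
  `{ω ≠ 0}`, `= 0` on `{ω = 0}` — Lean's `0^{−r} = 0` realises Constantin's convention) has
  `∫⁻_{[0,T] × T^d} D₀ ≤ (‖ω₀‖₁ + ‖u₀‖₂²/(2ν))/ν`, `‖ω₀‖₁ = ∫(|ω₀|²)^{1/2}`, as a lower Lebesgue
  integral (so the space–time integrability of `D₀` is a conclusion, not a hypothesis).

Scope (faithfulness): classical solutions on the unit torus; constants as printed.
-- TODO(general form): the `ℝ³` fact `constantin1990_direction_dissipation_bound` (classical
-- Leray–Hopf solutions on `ℝ³ × [0, T]`; needs decay at spatial infinity).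

## Mathlib / tree search

Tree (used): `Torus.IsClassicalNSSolutionOn.hasDerivWithinAt_integral_comp_torusVorticitySqAt`
(`TorusWeightedVorticityBalance`), `torusStretchingDensity_eq_sum_strain_of_equiv_of_isDivFree`,
`torusVorticitySqAt_eq_sum_sq_of_equiv` (`TorusVorticityTensorTransport`),
`integral_strainNormSq_eq_torusEnstrophy`, `integral_torusVorticitySqAt_eq_two_mul_torusEnstrophy`
(`TorusStrainVorticityIsometry`), `Torus.classicalNS_integral_gradNormSq_le`
(`TorusNSFoiasGuillopeTemam`), `Torus.IsClassicalNSSolutionOn.hasDerivWithinAt_half_gradNormSq`,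
`Torus.IsSmoothSpaceTimeOn.{partialDeriv,apply,mul,sub,sum,const_smul,comp_contDiffOn,continuousOn_stLift}`,
`Torus.IsClassicalNSSolutionOn.mono` (`TorusClassicalNSGluing`),
`Torus.eventually_norm_sub_lt_of_continuousOn`, `Torus.exists_norm_le_of_continuousOn_of_isCompact`,
`Torus.aestronglyMeasurable_uncurry_of_stLift_restrict`; Mathlib `Finset.sum_mul_sq_le_sq_mul_sq`,
`intervalIntegral.sub_le_integral_of_hasDeriv_right_of_le`, `Filter.EventuallyEq.deriv_eq`,
`MeasureTheory.lintegral_liminf_le'` (Fatou), `MeasureTheory.ofReal_integral_eq_lintegral_ofReal`,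
`MeasureTheory.integral_prod`.
Searched (`lean search`): `directionDissipation|∇ξ|vorticityDirection` — only the `ℝ³` named fact
`constantin1990_direction_dissipation_bound` (`ConstantinDirectionDissipation`) and the Summits-side
`TorusDirectionCoherent` (`FunctionalMining/CFMoment`); no torus direction-dissipation statement.

## References

* [Constantin1990] P. Constantin, *Navier–Stokes equations and area of interfaces*, Comm. Math.
  Phys. 129 (1990) 241–266, §2 (2.6)–(2.7), (2.21) (periodic box).
* [Constantin2003NearIdentity] P. Constantin, *Near identity transformations for the Navier–Stokes
  equations*, Handbook of Mathematical Fluid Dynamics II (2003), §3 Thm 2.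
* [Gibbon2010] J. D. Gibbon, *Regularity and singularity in solutions of the three-dimensional
  Navier–Stokes equations*, Proc. R. Soc. A 466 (2010), App. A (the weighted vorticity balance).
-/

noncomputable section

open Set MeasureTheory intervalIntegral Filter Real
open scoped ContDiff InnerProductSpace RealInnerProductSpace Topology ENNReal NNReal

namespace Literature.Analysis.FluidPDE

open Literature.Analysis.FunctionSpaces

variable {d : Type*} [Fintype d] [DecidableEq d]

/-! ### Smoothness of the vorticity objects (private copies) -/

/-- `Wᵢⱼ` of a smooth field is smooth. [folklore] -/
private theorem isSmooth_W₉ {v : UnitAddTorus d → EuclideanSpace ℝ d} (hv : Torus.IsSmooth v)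
    (i j : d) : Torus.IsSmooth (torusVorticityTensor v i j) :=
  ((hv.partialDeriv i).apply j).sub ((hv.partialDeriv j).apply i)

omit [DecidableEq d] in
/-- Finite double sums of smooth scalar functions on the torus are smooth. [folklore] -/
private theorem isSmooth_sum₂₉ {g : d → d → UnitAddTorus d → ℝ} (hg : ∀ i j, Torus.IsSmooth (g i j)) :
    Torus.IsSmooth (fun y => ∑ i, ∑ j, g i j y) := by
  have hl : Torus.lift (fun y => ∑ i, ∑ j, g i j y) = fun z => ∑ i, ∑ j, Torus.lift (g i j) z := by
    funext z; simp only [Torus.lift_apply]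
  unfold Torus.IsSmooth at hg ⊢
  rw [hl]
  exact ContDiff.sum fun i _ => ContDiff.sum fun j _ => hg i j

omit [DecidableEq d] in
/-- Finite sums of smooth scalar functions on the torus are smooth. [folklore] -/
private theorem isSmooth_sum₁₉ {g : d → UnitAddTorus d → ℝ} (hg : ∀ i, Torus.IsSmooth (g i)) :
    Torus.IsSmooth (fun y => ∑ i, g i y) := by
  have hl : Torus.lift (fun y => ∑ i, g i y) = fun z => ∑ i, Torus.lift (g i) z := by
    funext z; simp only [Torus.lift_apply]
  unfold Torus.IsSmooth at hg ⊢
  rw [hl]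
  exact ContDiff.sum fun i _ => hg i

/-- `|ω|²` of a smooth field is smooth. [folklore] -/
private theorem isSmooth_Q₉ {v : UnitAddTorus d → EuclideanSpace ℝ d} (hv : Torus.IsSmooth v) :
    Torus.IsSmooth (torusVorticitySqAt v) := by
  have h : Torus.IsSmooth (fun y => ∑ i, ∑ j, torusVorticityTensor v i j y ^ 2) :=
    isSmooth_sum₂₉ fun i j => (isSmooth_W₉ hv i j).pow 2
  have e : torusVorticitySqAt v = fun y => (2⁻¹ : ℝ) * ∑ i, ∑ j, torusVorticityTensor v i j y ^ 2 := by
    funext y; rfl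
  rw [e]
  exact (Torus.isSmooth_const _).mul h

/-! ### `|∇|ω|²|² ≤ 2|ω|² ∑ₖᵢⱼ(∂ₖWᵢⱼ)²` and nonnegativity of the regularised density -/

/-- **`∑ₖ (∂ₖ|ω|²)² ≤ 2|ω|² ∑ₖ∑ᵢⱼ (∂ₖWᵢⱼ)²`** for a smooth field on `T^d` (`|ω|² = ½∑ᵢⱼWᵢⱼ²`, so
`∂ₖ|ω|² = ∑ᵢⱼ Wᵢⱼ∂ₖWᵢⱼ` and Cauchy–Schwarz; in `d = 3` this is `|∇|ω|| ≤ |∇ω|` off the zero set,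
the inequality behind `|∇ω|² = |∇|ω||² + |ω|²|∇ξ|² ≥ |∇|ω||²`, Constantin 1990 (2.6)–(2.7)).
[cite: Constantin1990, §2 (2.6)–(2.7)] -/
theorem Torus.sum_sq_partialDeriv_torusVorticitySqAt_le {v : UnitAddTorus d → EuclideanSpace ℝ d}
    (hv : Torus.IsSmooth v) (x : UnitAddTorus d) :
    ∑ k, Torus.partialDeriv k (torusVorticitySqAt v) x ^ 2 ≤
      2 * torusVorticitySqAt v x *
        ∑ k, ∑ i, ∑ j, Torus.partialDeriv k (torusVorticityTensor v i j) x ^ 2 := by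
  have hW : ∀ i j, Torus.IsSmooth (torusVorticityTensor v i j) := fun i j => isSmooth_W₉ hv i j
  have hW1 : ∀ i j, Torus.IsContDiff 1 (torusVorticityTensor v i j) :=
    fun i j => (hW i j).isContDiff (by simp)
  -- `∂ₖ|ω|² = ∑ᵢⱼ Wᵢⱼ ∂ₖWᵢⱼ`
  have hdQ : ∀ k, Torus.partialDeriv k (torusVorticitySqAt v) x =
      ∑ i, ∑ j, torusVorticityTensor v i j x * Torus.partialDeriv k (torusVorticityTensor v i j) x := by
    intro k
    have e : torusVorticitySqAt v = fun y => ∑ i, (fun y => ∑ j,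
        (2⁻¹ : ℝ) * (torusVorticityTensor v i j y * torusVorticityTensor v i j y)) y := by
      funext y
      simp only [torusVorticitySqAt, torusVorticityTensor, Finset.mul_sum, sq]
    have hWW : ∀ i j, Torus.IsSmooth (fun y => torusVorticityTensor v i j y * torusVorticityTensor v i j y) :=
      fun i j => (hW i j).mul (hW i j)
    have hcWW : ∀ i j, Torus.IsSmooth (fun y => (2⁻¹ : ℝ) *
        (torusVorticityTensor v i j y * torusVorticityTensor v i j y)) :=
      fun i j => (Torus.isSmooth_const _).mul (hWW i j)
    have hsm : ∀ i j, Torus.IsContDiff 1 (fun y => (2⁻¹ : ℝ) *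
        (torusVorticityTensor v i j y * torusVorticityTensor v i j y)) := fun i j =>
      (hcWW i j).isContDiff (by simp)
    have hsi : ∀ i, Torus.IsContDiff 1 (fun y => ∑ j,
        (2⁻¹ : ℝ) * (torusVorticityTensor v i j y * torusVorticityTensor v i j y)) := fun i =>
      (isSmooth_sum₁₉ fun j => hcWW i j).isContDiff (by simp)
    rw [e, Torus.partialDeriv_finset_sum Finset.univ (fun i _ => hsi i) k x]
    refine Finset.sum_congr rfl fun i _ => ?_
    rw [Torus.partialDeriv_finset_sum Finset.univ (fun j _ => hsm i j) k x]
    refine Finset.sum_congr rfl fun j _ => ?_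
    have h1 : Torus.partialDeriv k (fun y => (2⁻¹ : ℝ) *
        (torusVorticityTensor v i j y * torusVorticityTensor v i j y)) x =
        2⁻¹ * Torus.partialDeriv k (fun y => torusVorticityTensor v i j y * torusVorticityTensor v i j y) x := by
      have := Torus.partialDeriv_const_smul ((hWW i j).isContDiff (by simp)) (2⁻¹ : ℝ) k
      have e2 : (fun y => (2⁻¹ : ℝ) * (torusVorticityTensor v i j y * torusVorticityTensor v i j y)) =
          (2⁻¹ : ℝ) • fun y => torusVorticityTensor v i j y * torusVorticityTensor v i j y := by
        funext y; simp [smul_eq_mul]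
      rw [e2, this]; simp [smul_eq_mul]
    rw [h1, Torus.partialDeriv_mul (hW1 i j) (hW1 i j) k x]
    ring
  -- Cauchy–Schwarz for each `k`
  have hCS : ∀ k, (∑ i, ∑ j, torusVorticityTensor v i j x *
      Torus.partialDeriv k (torusVorticityTensor v i j) x) ^ 2 ≤
      (∑ i, ∑ j, torusVorticityTensor v i j x ^ 2) *
        ∑ i, ∑ j, Torus.partialDeriv k (torusVorticityTensor v i j) x ^ 2 := by
    intro k
    have h := Finset.sum_mul_sq_le_sq_mul_sq (Finset.univ : Finset (d × d))
      (fun q => torusVorticityTensor v q.1 q.2 x)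
      (fun q => Torus.partialDeriv k (torusVorticityTensor v q.1 q.2) x)
    simpa only [Fintype.sum_prod_type] using h
  have hQ : torusVorticitySqAt v x = 2⁻¹ * ∑ i, ∑ j, torusVorticityTensor v i j x ^ 2 := rfl
  rw [hQ, Finset.mul_sum]
  refine Finset.sum_le_sum fun k _ => ?_
  rw [hdQ k]
  have := hCS k
  nlinarith [this]

/-- **The regularised direction-dissipation density is nonnegative**: for every `ε` and every
smooth field, `0 ≤ ½(|ω|²+ε²)^{−1/2}∑ₖᵢⱼ(∂ₖWᵢⱼ)² − ¼(|ω|²+ε²)^{−3/2}∑ₖ(∂ₖ|ω|²)²`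
(indeed `≥ ½ε²(|ω|²+ε²)^{−3/2}∑ₖᵢⱼ(∂ₖWᵢⱼ)²`, by `Torus.sum_sq_partialDeriv_torusVorticitySqAt_le`;
in `d = 3` the density is `(|∇ω|²(|ω|²+ε²) − |ω|²|∇|ω||²)/(|ω|²+ε²)^{3/2} ≥ |ω|⁴|∇ξ|²/(|ω|²+ε²)^{3/2}`,
Constantin's `|ω||∇ξ|²` at `ε = 0`). [cite: Constantin1990, §2 (2.6)–(2.7)] -/
theorem Torus.directionDissipationReg_nonneg {v : UnitAddTorus d → EuclideanSpace ℝ d}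
    (hv : Torus.IsSmooth v) {ε : ℝ} (hε : 0 < ε) (x : UnitAddTorus d) :
    0 ≤ 2⁻¹ * (torusVorticitySqAt v x + ε ^ 2) ^ (-(1 : ℝ) / 2) *
        (∑ k, ∑ i, ∑ j, Torus.partialDeriv k (torusVorticityTensor v i j) x ^ 2) -
      4⁻¹ * (torusVorticitySqAt v x + ε ^ 2) ^ (-(3 : ℝ) / 2) *
        ∑ k, Torus.partialDeriv k (torusVorticitySqAt v) x ^ 2 := by
  set Q : ℝ := torusVorticitySqAt v x with hQ
  set G : ℝ := ∑ k, ∑ i, ∑ j, Torus.partialDeriv k (torusVorticityTensor v i j) x ^ 2 with hG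
  set P : ℝ := ∑ k, Torus.partialDeriv k (torusVorticitySqAt v) x ^ 2 with hP
  have hQ0 : 0 ≤ Q := torusVorticitySqAt_nonneg v x
  have hG0 : 0 ≤ G := Finset.sum_nonneg fun k _ =>
    Finset.sum_nonneg fun i _ => Finset.sum_nonneg fun j _ => sq_nonneg _
  have hA : 0 < Q + ε ^ 2 := by positivity
  have hPle : P ≤ 2 * Q * G := Torus.sum_sq_partialDeriv_torusVorticitySqAt_le hv x
  have e1 : (Q + ε ^ 2) ^ (-(1 : ℝ) / 2) = (Q + ε ^ 2) * (Q + ε ^ 2) ^ (-(3 : ℝ) / 2) := by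
    rw [show -(1 : ℝ) / 2 = 1 + -(3 : ℝ) / 2 by norm_num, Real.rpow_add hA, Real.rpow_one]
  rw [e1]
  have hB : 0 ≤ (Q + ε ^ 2) ^ (-(3 : ℝ) / 2) := Real.rpow_nonneg hA.le _
  nlinarith [mul_nonneg hB hG0, mul_nonneg hB (sub_nonneg.2 hPle), sq_nonneg ε,
    mul_nonneg (mul_nonneg hB hG0) (sq_nonneg ε)]

/-! ### The stretching term against the regularised weight -/

omit [DecidableEq d] in
/-- Cauchy–Schwarz for a quadratic form over a finite index type:
`(∑ᵢⱼ wᵢ Sᵢⱼ wⱼ)² ≤ (∑ᵢⱼ Sᵢⱼ²)(∑ᵢ wᵢ²)²`. [folklore] -/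
private theorem quadForm_sq_le₉ (S : d → d → ℝ) (w : d → ℝ) :
    (∑ i, ∑ j, w i * S i j * w j) ^ 2 ≤ (∑ i, ∑ j, S i j ^ 2) * (∑ i, w i ^ 2) ^ 2 := by
  have h := Finset.sum_mul_sq_le_sq_mul_sq (Finset.univ : Finset (d × d))
    (fun q => S q.1 q.2) (fun q => w q.1 * w q.2)
  have h1 : ∑ q : d × d, S q.1 q.2 * (w q.1 * w q.2) = ∑ i, ∑ j, w i * S i j * w j := by
    rw [Fintype.sum_prod_type]
    exact Finset.sum_congr rfl fun i _ => Finset.sum_congr rfl fun j _ => by ring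
  have h2 : ∑ q : d × d, S q.1 q.2 ^ 2 = ∑ i, ∑ j, S i j ^ 2 := by
    rw [Fintype.sum_prod_type]
  have h3 : ∑ q : d × d, (w q.1 * w q.2) ^ 2 = (∑ i, w i ^ 2) ^ 2 := by
    rw [Fintype.sum_prod_type, sq (∑ i, w i ^ 2), Finset.sum_mul_sum]
    exact Finset.sum_congr rfl fun i _ => Finset.sum_congr rfl fun j _ => by ring
  rw [h1, h2, h3] at h
  exact h

/-- **`|σ| ≤ |S|_F |ω|²` pointwise on `T³`** (`card d = 3`, divergence-free, `C¹`): the stretching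
density `σ = ωᵀSω` (`torusStretchingDensity_eq_sum_strain_of_equiv_of_isDivFree`) against the
`d`-indexed strain `Sᵢⱼ = ½((∂ⱼv)ᵢ + (∂ᵢv)ⱼ)`, by Cauchy–Schwarz ("`∫(ξ·Sξ)|ω| ≤ ‖∇u‖₂‖ω‖₂`",
Constantin 1990, after (2.7)). [cite: Constantin1990, §2 (2.7)] -/
private theorem abs_torusStretchingDensity_le₉ (hd : Fintype.card d = 3)
    {v : UnitAddTorus d → EuclideanSpace ℝ d} (hv : Torus.IsContDiff 1 v) (hdiv : Torus.IsDivFree v)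
    (x : UnitAddTorus d) :
    |torusStretchingDensity v x| ≤
      Real.sqrt (∑ i, ∑ j, ((Torus.partialDeriv j v x i + Torus.partialDeriv i v x j) / 2) ^ 2) *
        torusVorticitySqAt v x := by
  obtain ⟨e⟩ : Nonempty (d ≃ Fin 3) := ⟨Fintype.equivFinOfCardEq hd⟩
  rw [torusStretchingDensity_eq_sum_strain_of_equiv_of_isDivFree e hv hdiv x,
    torusVorticitySqAt_eq_sum_sq_of_equiv e v x]
  set w : d → ℝ := fun i => torusVorticityTensor v (e.symm (e i + 1)) (e.symm (e i + 2)) x with hw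
  set S : d → d → ℝ := fun i j => (Torus.partialDeriv j v x i + Torus.partialDeriv i v x j) / 2 with hS
  have hcs := quadForm_sq_le₉ S w
  have hs0 : 0 ≤ ∑ i, ∑ j, S i j ^ 2 :=
    Finset.sum_nonneg fun i _ => Finset.sum_nonneg fun j _ => sq_nonneg _
  have hw0 : 0 ≤ ∑ i, w i ^ 2 := Finset.sum_nonneg fun i _ => sq_nonneg _
  have hgoal : |∑ i, ∑ j, w i * S i j * w j| ≤ Real.sqrt (∑ i, ∑ j, S i j ^ 2) * ∑ i, w i ^ 2 := by
    calc |∑ i, ∑ j, w i * S i j * w j| = Real.sqrt ((∑ i, ∑ j, w i * S i j * w j) ^ 2) :=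
          (Real.sqrt_sq_eq_abs _).symm
      _ ≤ Real.sqrt ((∑ i, ∑ j, S i j ^ 2) * (∑ i, w i ^ 2) ^ 2) := Real.sqrt_le_sqrt hcs
      _ = Real.sqrt (∑ i, ∑ j, S i j ^ 2) * ∑ i, w i ^ 2 := by
          rw [Real.sqrt_mul hs0, Real.sqrt_sq hw0]
  simpa only [hw, hS] using hgoal

/-- **The regularised stretching term is bounded by `½(|S|²_F + |ω|²)` pointwise**:
`σ (|ω|² + ε²)^{−1/2} ≤ |S|_F |ω|² (|ω|² + ε²)^{−1/2} ≤ |S|_F |ω| ≤ ½(|S|²_F + |ω|²)`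
(`card d = 3`, divergence-free). [cite: Constantin1990, §2 (2.7) and (2.21)] -/
private theorem stretching_rpow_le₉ (hd : Fintype.card d = 3)
    {v : UnitAddTorus d → EuclideanSpace ℝ d} (hv : Torus.IsContDiff 1 v) (hdiv : Torus.IsDivFree v)
    {ε : ℝ} (hε : 0 < ε) (x : UnitAddTorus d) :
    (torusVorticitySqAt v x + ε ^ 2) ^ (-(1 : ℝ) / 2) * torusStretchingDensity v x ≤
      2⁻¹ * ((∑ i, ∑ j, ((Torus.partialDeriv j v x i + Torus.partialDeriv i v x j) / 2) ^ 2) +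
        torusVorticitySqAt v x) := by
  set Q : ℝ := torusVorticitySqAt v x with hQ
  set s : ℝ := ∑ i, ∑ j, ((Torus.partialDeriv j v x i + Torus.partialDeriv i v x j) / 2) ^ 2 with hs
  set σ : ℝ := torusStretchingDensity v x with hσ
  have hQ0 : 0 ≤ Q := torusVorticitySqAt_nonneg v x
  have hs0 : 0 ≤ s := Finset.sum_nonneg fun i _ => Finset.sum_nonneg fun j _ => sq_nonneg _
  have hA : 0 < Q + ε ^ 2 := by positivity
  have habs : |σ| ≤ Real.sqrt s * Q := abs_torusStretchingDensity_le₉ hd hv hdiv x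
  -- `(Q+ε²)^{-1/2} = 1/√(Q+ε²)` and `Q/√(Q+ε²) ≤ √Q`
  have hr : (Q + ε ^ 2) ^ (-(1 : ℝ) / 2) = (Real.sqrt (Q + ε ^ 2))⁻¹ := by
    rw [Real.sqrt_eq_rpow, ← Real.rpow_neg hA.le]; norm_num
  have hsA : 0 < Real.sqrt (Q + ε ^ 2) := Real.sqrt_pos.2 hA
  have hQA : Q * (Real.sqrt (Q + ε ^ 2))⁻¹ ≤ Real.sqrt Q := by
    rw [mul_inv_le_iff₀ hsA]
    have h1 : Real.sqrt Q ≤ Real.sqrt (Q + ε ^ 2) := Real.sqrt_le_sqrt (by linarith [sq_nonneg ε])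
    calc Q = Real.sqrt Q * Real.sqrt Q := (Real.mul_self_sqrt hQ0).symm
      _ ≤ Real.sqrt Q * Real.sqrt (Q + ε ^ 2) := mul_le_mul_of_nonneg_left h1 (Real.sqrt_nonneg _)
  -- AM–GM: `√s √Q ≤ ½(s + Q)`
  have hamgm : Real.sqrt s * Real.sqrt Q ≤ 2⁻¹ * (s + Q) := by
    nlinarith [sq_nonneg (Real.sqrt s - Real.sqrt Q), Real.sq_sqrt hs0, Real.sq_sqrt hQ0]
  rw [hr]
  calc (Real.sqrt (Q + ε ^ 2))⁻¹ * σ ≤ (Real.sqrt (Q + ε ^ 2))⁻¹ * |σ| :=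
        mul_le_mul_of_nonneg_left (le_abs_self σ) (inv_nonneg.2 hsA.le)
    _ ≤ (Real.sqrt (Q + ε ^ 2))⁻¹ * (Real.sqrt s * Q) :=
        mul_le_mul_of_nonneg_left habs (inv_nonneg.2 hsA.le)
    _ = Real.sqrt s * (Q * (Real.sqrt (Q + ε ^ 2))⁻¹) := by ring
    _ ≤ Real.sqrt s * Real.sqrt Q := mul_le_mul_of_nonneg_left hQA (Real.sqrt_nonneg _)
    _ ≤ 2⁻¹ * (s + Q) := hamgm

/-! ### Joint smoothness along a classical solution (private copies) and the tube lemma -/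

/-- Along a jointly smooth `u` on `[a, b] × T^d`, `(s, y) ↦ Wᵢⱼ(u(s))(y)` is jointly smooth. [folklore] -/
private theorem isSmoothSpaceTimeOn_W₉ {a b : ℝ}
    {u : ℝ → UnitAddTorus d → EuclideanSpace ℝ d} (hu : Torus.IsSmoothSpaceTimeOn (Icc a b) u)
    (hab : a < b) (i j : d) :
    Torus.IsSmoothSpaceTimeOn (Icc a b) (fun s y => torusVorticityTensor (u s) i j y) :=
  ((hu.partialDeriv (uniqueDiffOn_Icc hab) i).apply j).sub
    ((hu.partialDeriv (uniqueDiffOn_Icc hab) j).apply i)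

/-- Along a jointly smooth `u` on `[a, b] × T^d`, `(s, y) ↦ |ω(u(s))(y)|²` is jointly smooth. [folklore] -/
private theorem isSmoothSpaceTimeOn_Q₉ {a b : ℝ}
    {u : ℝ → UnitAddTorus d → EuclideanSpace ℝ d} (hu : Torus.IsSmoothSpaceTimeOn (Icc a b) u)
    (hab : a < b) :
    Torus.IsSmoothSpaceTimeOn (Icc a b) (fun s y => torusVorticitySqAt (u s) y) := by
  have h : ∀ i j, Torus.IsSmoothSpaceTimeOn (Icc a b)
      (fun s y => torusVorticityTensor (u s) i j y * torusVorticityTensor (u s) i j y) :=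
    fun i j => (isSmoothSpaceTimeOn_W₉ hu hab i j).mul (isSmoothSpaceTimeOn_W₉ hu hab i j)
  have hs := Torus.IsSmoothSpaceTimeOn.sum (s := Finset.univ) fun i (_ : i ∈ Finset.univ) =>
    Torus.IsSmoothSpaceTimeOn.sum (s := Finset.univ) fun j (_ : j ∈ Finset.univ) => h i j
  have hfun : (fun s y => torusVorticitySqAt (u s) y) = fun s y => (2⁻¹ : ℝ) •
      ∑ i, ∑ j, torusVorticityTensor (u s) i j y * torusVorticityTensor (u s) i j y := by
    funext s y
    simp only [torusVorticitySqAt, torusVorticityTensor, smul_eq_mul, sq]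
  rw [hfun]
  exact hs.const_smul (2⁻¹ : ℝ)

omit [DecidableEq d] in
/-- Continuity of `t ↦ ∫ φ(t, x) dx` on `S` for `φ` with continuous space–time lift (tube lemma
on the compact torus). [folklore] -/
private theorem continuousOn_integral_of_continuousOn_stLift₉ {S : Set ℝ}
    {φ : ℝ → UnitAddTorus d → ℝ} (hφ : ContinuousOn (Torus.stLift φ) (S ×ˢ univ))
    (hsl : ∀ t ∈ S, Continuous (φ t)) : ContinuousOn (fun t => ∫ x, φ t x) S := by
  intro t ht
  rw [ContinuousWithinAt, Metric.tendsto_nhds]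
  intro ε hε
  have h := Torus.eventually_norm_sub_lt_of_continuousOn hφ ht (half_pos hε)
  filter_upwards [h, self_mem_nhdsWithin] with s hs hsS
  have his : Integrable (φ s) := (hsl s hsS).integrable_unitAddTorus
  have hit : Integrable (φ t) := (hsl t ht).integrable_unitAddTorus
  rw [Real.dist_eq, ← integral_sub his hit]
  calc |∫ x, (φ s x - φ t x)| ≤ ∫ x, |φ s x - φ t x| := MeasureTheory.abs_integral_le_integral_abs
    _ ≤ ∫ _x : UnitAddTorus d, ε / 2 := by
        refine integral_mono_of_nonneg (ae_of_all _ fun x => abs_nonneg _) (integrable_const _)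
          (ae_of_all _ fun x => ?_)
        have h1 := hs x
        rw [Real.norm_eq_abs] at h1
        exact h1.le
    _ = ε / 2 := by simp
    _ < ε := half_lt_self hε

/-- Continuity of a slice of the regularised density (`v` smooth, `ε > 0`). [folklore] -/
private theorem continuous_D₉ {v : UnitAddTorus d → EuclideanSpace ℝ d} (hv : Torus.IsSmooth v)
    {ε : ℝ} (hε : 0 < ε) :
    Continuous fun x =>
      2⁻¹ * (torusVorticitySqAt v x + ε ^ 2) ^ (-(1 : ℝ) / 2) *
          (∑ k, ∑ i, ∑ j, Torus.partialDeriv k (torusVorticityTensor v i j) x ^ 2) -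
        4⁻¹ * (torusVorticitySqAt v x + ε ^ 2) ^ (-(3 : ℝ) / 2) *
          ∑ k, Torus.partialDeriv k (torusVorticitySqAt v) x ^ 2 := by
  have hQs : Torus.IsSmooth (torusVorticitySqAt v) := isSmooth_Q₉ hv
  have hA : ∀ x, 0 < torusVorticitySqAt v x + ε ^ 2 := fun x => by
    have := torusVorticitySqAt_nonneg v x
    positivity
  have cQ : Continuous (torusVorticitySqAt v) := hQs.continuous
  exact ((continuous_const.mul ((cQ.add continuous_const).rpow_const fun x => Or.inl (hA x).ne')).mul
    (continuous_finsetSum _ fun k _ => continuous_finsetSum _ fun i _ =>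
      continuous_finsetSum _ fun j _ => ((isSmooth_W₉ hv i j).partialDeriv k).continuous.pow 2)).sub
    ((continuous_const.mul ((cQ.add continuous_const).rpow_const fun x => Or.inl (hA x).ne')).mul
      (continuous_finsetSum _ fun k _ => (hQs.partialDeriv k).continuous.pow 2))

/-- Joint continuity of the regularised density along a jointly smooth `u` on `[0, T] × T^d`
(`ε > 0`). [folklore] -/
private theorem continuousOn_stLift_D₉ {T : ℝ} (hT : 0 < T)
    {u : ℝ → UnitAddTorus d → EuclideanSpace ℝ d} (hu : Torus.IsSmoothSpaceTimeOn (Icc 0 T) u)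
    {ε : ℝ} (hε : 0 < ε) :
    ContinuousOn (Torus.stLift fun τ x =>
      2⁻¹ * (torusVorticitySqAt (u τ) x + ε ^ 2) ^ (-(1 : ℝ) / 2) *
          (∑ k, ∑ i, ∑ j, Torus.partialDeriv k (torusVorticityTensor (u τ) i j) x ^ 2) -
        4⁻¹ * (torusVorticitySqAt (u τ) x + ε ^ 2) ^ (-(3 : ℝ) / 2) *
          ∑ k, Torus.partialDeriv k (torusVorticitySqAt (u τ)) x ^ 2) (Icc 0 T ×ˢ univ) := by
  have hU : UniqueDiffOn ℝ (Icc 0 T) := uniqueDiffOn_Icc hT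
  have hQst := isSmoothSpaceTimeOn_Q₉ hu hT
  have hWst := fun i j => isSmoothSpaceTimeOn_W₉ hu hT i j
  have cQst : ContinuousOn (Torus.stLift (fun s y => torusVorticitySqAt (u s) y)) (Icc 0 T ×ˢ univ) :=
    hQst.continuousOn_stLift
  have hApos : ∀ z ∈ Icc 0 T ×ˢ (univ : Set (EuclideanSpace ℝ d)),
      0 < Torus.stLift (fun s y => torusVorticitySqAt (u s) y) z + ε ^ 2 := fun z _ => by
    have := torusVorticitySqAt_nonneg (u z.1) (Torus.proj z.2)
    show 0 < torusVorticitySqAt (u z.1) (Torus.proj z.2) + ε ^ 2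
    positivity
  have cdW : ∀ k i j, ContinuousOn (Torus.stLift (fun s y =>
      Torus.partialDeriv k (torusVorticityTensor (u s) i j) y)) (Icc 0 T ×ˢ univ) :=
    fun k i j => ((hWst i j).partialDeriv hU k).continuousOn_stLift
  have cdQ : ∀ k, ContinuousOn (Torus.stLift (fun s y =>
      Torus.partialDeriv k (torusVorticitySqAt (u s)) y)) (Icc 0 T ×ˢ univ) :=
    fun k => (hQst.partialDeriv hU k).continuousOn_stLift
  have e' : Torus.stLift (fun τ x =>
      (2⁻¹ * (torusVorticitySqAt (u τ) x + ε ^ 2) ^ (-(1 : ℝ) / 2) *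
          (∑ k, ∑ i, ∑ j, Torus.partialDeriv k (torusVorticityTensor (u τ) i j) x ^ 2) -
        4⁻¹ * (torusVorticitySqAt (u τ) x + ε ^ 2) ^ (-(3 : ℝ) / 2) *
          ∑ k, Torus.partialDeriv k (torusVorticitySqAt (u τ)) x ^ 2)) =
      fun z => 2⁻¹ * (Torus.stLift (fun s y => torusVorticitySqAt (u s) y) z + ε ^ 2) ^ (-(1 : ℝ) / 2) *
          (∑ k, ∑ i, ∑ j, Torus.stLift (fun s y =>
            Torus.partialDeriv k (torusVorticityTensor (u s) i j) y) z ^ 2) -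
        4⁻¹ * (Torus.stLift (fun s y => torusVorticitySqAt (u s) y) z + ε ^ 2) ^ (-(3 : ℝ) / 2) *
          ∑ k, Torus.stLift (fun s y => Torus.partialDeriv k (torusVorticitySqAt (u s)) y) z ^ 2 := rfl
  rw [e']
  refine ((continuousOn_const.mul ((cQst.add continuousOn_const).rpow_const
    fun z hz => Or.inl (hApos z hz).ne')).mul (continuousOn_finsetSum _ fun k _ =>
      continuousOn_finsetSum _ fun i _ => continuousOn_finsetSum _ fun j _ =>
        (cdW k i j).pow 2)).sub ?_
  exact (continuousOn_const.mul ((cQst.add continuousOn_const).rpow_const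
    fun z hz => Or.inl (hApos z hz).ne')).mul (continuousOn_finsetSum _ fun k _ => (cdQ k).pow 2)

omit [DecidableEq d] in
/-- `∫(|ω|²+ε²)^{1/2} ≤ ∫(|ω|²)^{1/2} + ε` (`0 < ε`, `|ω|²` continuous). [folklore] -/
private theorem integral_rpow_half_add_sq_le₉ {Q : UnitAddTorus d → ℝ} (hQ : Continuous Q)
    (hQ0 : ∀ x, 0 ≤ Q x) {ε : ℝ} (hε : 0 < ε) :
    (∫ x, (Q x + ε ^ 2) ^ ((1 : ℝ) / 2)) ≤ (∫ x, Q x ^ ((1 : ℝ) / 2)) + ε := by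
  have i1 : Integrable (fun x => (Q x + ε ^ 2) ^ ((1 : ℝ) / 2)) :=
    ((hQ.add continuous_const).rpow_const fun x => Or.inr (by norm_num)).integrable_unitAddTorus
  have i0 : Integrable (fun x => Q x ^ ((1 : ℝ) / 2)) :=
    (hQ.rpow_const fun x => Or.inr (by norm_num)).integrable_unitAddTorus
  have hpt : ∀ x, (Q x + ε ^ 2) ^ ((1 : ℝ) / 2) ≤ Q x ^ ((1 : ℝ) / 2) + ε := by
    intro x
    have hq := hQ0 x
    rw [← Real.sqrt_eq_rpow, ← Real.sqrt_eq_rpow, Real.sqrt_le_left (by positivity)]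
    nlinarith [Real.sq_sqrt hq, Real.sqrt_nonneg (Q x), hε.le]
  calc (∫ x, (Q x + ε ^ 2) ^ ((1 : ℝ) / 2)) ≤ ∫ x, (Q x ^ ((1 : ℝ) / 2) + ε) :=
        integral_mono i1 (i0.add (integrable_const _)) hpt
    _ = (∫ x, Q x ^ ((1 : ℝ) / 2)) + ε := by
        rw [integral_add i0 (integrable_const _)]
        simp

/-! ### The budget -/

/-- The master inequality behind the budgets below (regularised, `ε > 0`):
`∫(|ω(T)|²+ε²)^{1/2} + ν∫₀ᵀ∫D_ε ≤ ∫(|ω₀|²+ε²)^{1/2} + (3/4)‖u₀‖₂²/(2ν)`.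
[cite: Constantin1990, §2 (2.6)–(2.7), (2.20)–(2.21)] -/
private theorem Torus.master_directionDissipationReg₉ (hd : Fintype.card d = 3) {ν T : ℝ}
    (hν : 0 < ν) (hT : 0 < T)
    {u : ℝ → UnitAddTorus d → EuclideanSpace ℝ d} {p : ℝ → UnitAddTorus d → ℝ}
    (h : Torus.IsClassicalNSSolutionOn (Icc 0 T) ν 0 u p) {ε : ℝ} (hε : 0 < ε) :
    (∫ x, (torusVorticitySqAt (u T) x + ε ^ 2) ^ ((1 : ℝ) / 2)) +
      ν * ∫ t in (0 : ℝ)..T, ∫ x,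
        (2⁻¹ * (torusVorticitySqAt (u t) x + ε ^ 2) ^ (-(1 : ℝ) / 2) *
            (∑ k, ∑ i, ∑ j, Torus.partialDeriv k (torusVorticityTensor (u t) i j) x ^ 2) -
          4⁻¹ * (torusVorticitySqAt (u t) x + ε ^ 2) ^ (-(3 : ℝ) / 2) *
            ∑ k, Torus.partialDeriv k (torusVorticitySqAt (u t)) x ^ 2) ≤
      (∫ x, (torusVorticitySqAt (u 0) x + ε ^ 2) ^ ((1 : ℝ) / 2)) +
        3 / 4 * ((∫ x, ‖u 0 x‖ ^ 2) / (2 * ν)) := by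
  have hU : UniqueDiffOn ℝ (Icc 0 T) := uniqueDiffOn_Icc hT
  have hε2 : 0 < ε ^ 2 := by positivity
  -- the weight `Φ(y) = (y + ε²)^{1/2}` on `U = (−ε², ∞)` and its derivatives
  set Φ : ℝ → ℝ := fun y => (y + ε ^ 2) ^ ((1 : ℝ) / 2) with hΦdef
  have hUo : IsOpen (Ioi (-ε ^ 2)) := isOpen_Ioi
  have hΦcd : ContDiffOn ℝ ((⊤ : ℕ∞) : WithTop ℕ∞) Φ (Ioi (-ε ^ 2)) := by
    refine (contDiffOn_id.add contDiffOn_const).rpow_const_of_ne fun y hy => ?_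
    have : -ε ^ 2 < y := hy
    simp only [id_eq]
    linarith
  have hmaps : ∀ s ∈ Icc 0 T, ∀ x, torusVorticitySqAt (u s) x ∈ Ioi (-ε ^ 2) := fun s _ x => by
    show -ε ^ 2 < torusVorticitySqAt (u s) x
    linarith [torusVorticitySqAt_nonneg (u s) x]
  have hd1 : ∀ y, -ε ^ 2 < y → deriv Φ y = 2⁻¹ * (y + ε ^ 2) ^ (-(1 : ℝ) / 2) := by
    intro y hy
    have hne : y + ε ^ 2 ≠ 0 := by
      intro h0; linarith
    have := (((hasDerivAt_id' y).add_const (ε ^ 2)).rpow_const (p := (1 : ℝ) / 2) (Or.inl hne)).deriv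
    rw [this, show (1 : ℝ) / 2 - 1 = -(1 : ℝ) / 2 by norm_num]
    ring
  have hd2 : ∀ y, -ε ^ 2 < y → deriv (deriv Φ) y = -(4⁻¹ * (y + ε ^ 2) ^ (-(3 : ℝ) / 2)) := by
    intro y hy
    have hne : y + ε ^ 2 ≠ 0 := by
      intro h0; linarith
    have hloc : deriv Φ =ᶠ[𝓝 y] fun z => 2⁻¹ * (z + ε ^ 2) ^ (-(1 : ℝ) / 2) := by
      filter_upwards [Ioi_mem_nhds hy] with z hz using hd1 z hz
    rw [hloc.deriv_eq]
    have := ((((hasDerivAt_id' y).add_const (ε ^ 2)).rpow_const (p := -(1 : ℝ) / 2)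
      (Or.inl hne)).const_mul (2⁻¹ : ℝ)).deriv
    rw [this, show -(1 : ℝ) / 2 - 1 = -(3 : ℝ) / 2 by norm_num]
    ring
  -- abbreviations
  obtain ⟨Y, hY⟩ : ∃ Y : ℝ → ℝ, ∀ τ, Y τ = ∫ x, (torusVorticitySqAt (u τ) x + ε ^ 2) ^ ((1 : ℝ) / 2) :=
    ⟨_, fun _ => rfl⟩
  obtain ⟨Dis, hDis⟩ : ∃ Dis : ℝ → ℝ, ∀ τ, Dis τ = ∫ x,
      (2⁻¹ * (torusVorticitySqAt (u τ) x + ε ^ 2) ^ (-(1 : ℝ) / 2) *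
          (∑ k, ∑ i, ∑ j, Torus.partialDeriv k (torusVorticityTensor (u τ) i j) x ^ 2) -
        4⁻¹ * (torusVorticitySqAt (u τ) x + ε ^ 2) ^ (-(3 : ℝ) / 2) *
          ∑ k, Torus.partialDeriv k (torusVorticitySqAt (u τ)) x ^ 2) := ⟨_, fun _ => rfl⟩
  obtain ⟨g, hg⟩ : ∃ g : ℝ → ℝ, ∀ τ, g τ = Torus.gradNormSq (u τ) := ⟨_, fun _ => rfl⟩
  have hus : ∀ τ ∈ Icc 0 T, Torus.IsSmooth (u τ) := fun τ hτ => h.smooth_velocity.isSmooth_slice hτ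
  have hY0 : ∀ τ, 0 ≤ Y τ := fun τ => by
    rw [hY]
    exact integral_nonneg fun x =>
      Real.rpow_nonneg (add_nonneg (torusVorticitySqAt_nonneg (u τ) x) (sq_nonneg ε)) _
  -- Step 1: the derivative of `Y` within `[0, T]` and its bound
  have hstep : ∀ t ∈ Icc 0 T, ∃ D : ℝ, HasDerivWithinAt Y D (Icc 0 T) t ∧
      D ≤ 3 / 4 * g t - ν * Dis t := by
    intro t ht
    have hD := h.hasDerivWithinAt_integral_comp_torusVorticitySqAt hT hUo hΦcd hmaps ht
    rw [show (fun s => ∫ x, Φ (torusVorticitySqAt (u s) x)) = Y from (funext hY).symm] at hD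
    refine ⟨_, hD, ?_⟩
    have hut : Torus.IsSmooth (u t) := hus t ht
    have hu1 : Torus.IsContDiff 1 (u t) := hut.isContDiff (by simp)
    have hdivt : Torus.IsDivFree (u t) := h.divFree t ht
    have hQs : Torus.IsSmooth (torusVorticitySqAt (u t)) := isSmooth_Q₉ hut
    have hWs : ∀ i j, Torus.IsSmooth (torusVorticityTensor (u t) i j) := fun i j => isSmooth_W₉ hut i j
    have hA : ∀ x, 0 < torusVorticitySqAt (u t) x + ε ^ 2 := fun x => by
      linarith [torusVorticitySqAt_nonneg (u t) x]
    -- continuity of the pointwise pieces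
    have cQ : Continuous (torusVorticitySqAt (u t)) := hQs.continuous
    have cA12 : Continuous (fun x => (torusVorticitySqAt (u t) x + ε ^ 2) ^ (-(1 : ℝ) / 2)) :=
      (cQ.add continuous_const).rpow_const fun x => Or.inl (hA x).ne'
    have cA32 : Continuous (fun x => (torusVorticitySqAt (u t) x + ε ^ 2) ^ (-(3 : ℝ) / 2)) :=
      (cQ.add continuous_const).rpow_const fun x => Or.inl (hA x).ne'
    have cG : Continuous (fun x => ∑ k, ∑ i, ∑ j,
        Torus.partialDeriv k (torusVorticityTensor (u t) i j) x ^ 2) :=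
      continuous_finsetSum _ fun k _ => continuous_finsetSum _ fun i _ =>
        continuous_finsetSum _ fun j _ => ((hWs i j).partialDeriv k).continuous.pow 2
    have cP : Continuous (fun x => ∑ k, Torus.partialDeriv k (torusVorticitySqAt (u t)) x ^ 2) :=
      continuous_finsetSum _ fun k _ => (hQs.partialDeriv k).continuous.pow 2
    have cσ : Continuous (torusStretchingDensity (u t)) := by
      have hD' : ∀ i k, Continuous (fun y => Torus.partialDeriv i (u t) y k) :=
        fun i k => ((hut.partialDeriv i).apply k).continuous
      have : Continuous (fun x => -∑ i, ∑ j, torusVorticityTensor (u t) i j x *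
          ∑ k, Torus.partialDeriv i (u t) x k * Torus.partialDeriv k (u t) x j) :=
        (continuous_finsetSum _ fun i _ => continuous_finsetSum _ fun j _ =>
          (hWs i j).continuous.mul (continuous_finsetSum _ fun k _ => (hD' i k).mul (hD' k j))).neg
      exact this
    have cS : Continuous (fun x => ∑ i, ∑ j,
        ((Torus.partialDeriv j (u t) x i + Torus.partialDeriv i (u t) x j) / 2) ^ 2) := by
      have hD' : ∀ i k, Continuous (fun y => Torus.partialDeriv i (u t) y k) :=
        fun i k => ((hut.partialDeriv i).apply k).continuous
      exact continuous_finsetSum _ fun i _ => continuous_finsetSum _ fun j _ =>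
        (((hD' j i).add (hD' i j)).div_const _).pow 2
    -- (a) the forcing term vanishes
    have e0 : (∫ x, deriv Φ (torusVorticitySqAt (u t) x) * ∑ i, ∑ j, torusVorticityTensor (u t) i j x *
        (Torus.partialDeriv i ((0 : ℝ → UnitAddTorus d → EuclideanSpace ℝ d) t) x j -
          Torus.partialDeriv j ((0 : ℝ → UnitAddTorus d → EuclideanSpace ℝ d) t) x i)) = 0 := by
      have hz : ∀ i x, Torus.partialDeriv i (0 : UnitAddTorus d → EuclideanSpace ℝ d) x = 0 := by
        intro i x
        simp [Torus.partialDeriv, Torus.lineDeriv]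
      simp [hz]
    -- (b) the viscous term is `ν ∫ D_ε`
    have e1 : (∫ x, deriv Φ (torusVorticitySqAt (u t) x) * ∑ k, ∑ i, ∑ j,
          Torus.partialDeriv k (torusVorticityTensor (u t) i j) x ^ 2) +
        (∫ x, deriv (deriv Φ) (torusVorticitySqAt (u t) x) *
          ∑ k, Torus.partialDeriv k (torusVorticitySqAt (u t)) x ^ 2) = Dis t := by
      rw [hDis t]
      have i1 : Integrable (fun x => 2⁻¹ * (torusVorticitySqAt (u t) x + ε ^ 2) ^ (-(1 : ℝ) / 2) *
          (∑ k, ∑ i, ∑ j, Torus.partialDeriv k (torusVorticityTensor (u t) i j) x ^ 2)) :=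
        ((continuous_const.mul cA12).mul cG).integrable_unitAddTorus
      have i2 : Integrable (fun x => 4⁻¹ * (torusVorticitySqAt (u t) x + ε ^ 2) ^ (-(3 : ℝ) / 2) *
          ∑ k, Torus.partialDeriv k (torusVorticitySqAt (u t)) x ^ 2) :=
        ((continuous_const.mul cA32).mul cP).integrable_unitAddTorus
      rw [integral_sub i1 i2]
      congr 1
      · exact integral_congr_ae (ae_of_all _ fun x => by
          dsimp only; rw [hd1 _ (hmaps t ht x)])
      · rw [← MeasureTheory.integral_neg]
        exact integral_congr_ae (ae_of_all _ fun x => by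
          dsimp only; rw [hd2 _ (hmaps t ht x)]; ring)
    -- (c) the stretching term is at most `(3/4)‖∇u‖₂²`
    have e2 : 2 * (∫ x, deriv Φ (torusVorticitySqAt (u t) x) * torusStretchingDensity (u t) x) ≤
        3 / 4 * g t := by
      have hpt : ∀ x, 2 * (deriv Φ (torusVorticitySqAt (u t) x) * torusStretchingDensity (u t) x) ≤
          2⁻¹ * ((∑ i, ∑ j, ((Torus.partialDeriv j (u t) x i + Torus.partialDeriv i (u t) x j) / 2) ^ 2) +
            torusVorticitySqAt (u t) x) := by
        intro x
        rw [hd1 _ (hmaps t ht x)]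
        have := stretching_rpow_le₉ hd hu1 hdivt hε x
        linarith
      have iL : Integrable (fun x => 2 * (deriv Φ (torusVorticitySqAt (u t) x) *
          torusStretchingDensity (u t) x)) := by
        have hc : Continuous (fun x => 2 * (2⁻¹ * (torusVorticitySqAt (u t) x + ε ^ 2) ^ (-(1 : ℝ) / 2) *
            torusStretchingDensity (u t) x)) := continuous_const.mul ((continuous_const.mul cA12).mul cσ)
        refine (hc.integrable_unitAddTorus).congr (ae_of_all _ fun x => ?_)
        dsimp only; rw [hd1 _ (hmaps t ht x)]
      have iR : Integrable (fun x => 2⁻¹ * ((∑ i, ∑ j,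
          ((Torus.partialDeriv j (u t) x i + Torus.partialDeriv i (u t) x j) / 2) ^ 2) +
            torusVorticitySqAt (u t) x)) := (continuous_const.mul (cS.add cQ)).integrable_unitAddTorus
      have hmono := integral_mono iL iR hpt
      rw [MeasureTheory.integral_const_mul, MeasureTheory.integral_const_mul,
        integral_add cS.integrable_unitAddTorus cQ.integrable_unitAddTorus,
        integral_strainNormSq_eq_torusEnstrophy hut hdivt,
        integral_torusVorticitySqAt_eq_two_mul_torusEnstrophy hut hdivt, torusEnstrophy, ← hg t] at hmono
      linarith
    -- assemble
    rw [e0, add_zero]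
    have := e1
    nlinarith [e2, e1, hν]
  -- Step 2: continuity in time of `Y`, `Dis`, `g`
  have hQst := isSmoothSpaceTimeOn_Q₉ h.smooth_velocity hT
  have cQst : ContinuousOn (Torus.stLift (fun s y => torusVorticitySqAt (u s) y)) (Icc 0 T ×ˢ univ) :=
    hQst.continuousOn_stLift
  have hYc : ContinuousOn Y (Icc 0 T) := by
    rw [show Y = fun τ => ∫ x, (torusVorticitySqAt (u τ) x + ε ^ 2) ^ ((1 : ℝ) / 2) from funext hY]
    refine continuousOn_integral_of_continuousOn_stLift₉
      (φ := fun τ x => (torusVorticitySqAt (u τ) x + ε ^ 2) ^ ((1 : ℝ) / 2)) ?_ fun τ hτ => ?_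
    · have e' : Torus.stLift (fun τ x => (torusVorticitySqAt (u τ) x + ε ^ 2) ^ ((1 : ℝ) / 2)) =
          fun z => (Torus.stLift (fun s y => torusVorticitySqAt (u s) y) z + ε ^ 2) ^ ((1 : ℝ) / 2) := rfl
      rw [e']
      exact (cQst.add continuousOn_const).rpow_const fun z hz => Or.inr (by norm_num)
    · exact ((isSmooth_Q₉ (hus τ hτ)).continuous.add continuous_const).rpow_const
        fun x => Or.inr (by norm_num)
  have hDisc : ContinuousOn Dis (Icc 0 T) := by
    rw [show Dis = fun τ => ∫ x,
      (2⁻¹ * (torusVorticitySqAt (u τ) x + ε ^ 2) ^ (-(1 : ℝ) / 2) *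
          (∑ k, ∑ i, ∑ j, Torus.partialDeriv k (torusVorticityTensor (u τ) i j) x ^ 2) -
        4⁻¹ * (torusVorticitySqAt (u τ) x + ε ^ 2) ^ (-(3 : ℝ) / 2) *
          ∑ k, Torus.partialDeriv k (torusVorticitySqAt (u τ)) x ^ 2) from funext hDis]
    exact continuousOn_integral_of_continuousOn_stLift₉ (continuousOn_stLift_D₉ hT h.smooth_velocity hε)
      fun τ hτ => continuous_D₉ (hus τ hτ) hε
  have hgc : ContinuousOn g (Icc 0 T) := by
    rw [show g = fun τ => Torus.gradNormSq (u τ) from funext hg]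
    intro t ht
    have h1 : ContinuousWithinAt (fun s => (2 : ℝ) * (2⁻¹ * Torus.gradNormSq (u s))) (Icc 0 T) t :=
      continuousWithinAt_const.mul (h.hasDerivWithinAt_half_gradNormSq hT ht).continuousWithinAt
    refine h1.congr (fun s _ => ?_) ?_ <;> ring
  -- Step 3: fundamental theorem of calculus on `[0, T]`
  choose! D hD using hstep
  have hφc : ContinuousOn (fun τ => 3 / 4 * g τ - ν * Dis τ) (Icc 0 T) :=
    (continuousOn_const.mul hgc).sub (continuousOn_const.mul hDisc)
  have hFTC := intervalIntegral.sub_le_integral_of_hasDeriv_right_of_le hT.le hYc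
    (fun τ hτ => ((hD τ ⟨hτ.1.le, hτ.2.le⟩).1).mono_of_mem_nhdsWithin
      (mem_nhdsWithin_of_mem_nhds (Icc_mem_nhds hτ.1 hτ.2)))
    (hφc.integrableOn_compact isCompact_Icc) (fun τ hτ => (hD τ ⟨hτ.1.le, hτ.2.le⟩).2)
  have huIcc : uIcc 0 T = Icc 0 T := uIcc_of_le hT.le
  have hgi : IntervalIntegrable g volume 0 T := (hgc.mono (by rw [huIcc])).intervalIntegrable
  have hDi : IntervalIntegrable Dis volume 0 T := (hDisc.mono (by rw [huIcc])).intervalIntegrable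
  rw [intervalIntegral.integral_sub (hgi.const_mul _) (hDi.const_mul _),
    intervalIntegral.integral_const_mul, intervalIntegral.integral_const_mul] at hFTC
  -- Step 4: the energy budget
  have hG := Torus.classicalNS_integral_gradNormSq_le hν hT h
  rw [show (fun t => Torus.gradNormSq (u t)) = g from (funext hg).symm] at hG
  -- conclusion
  rw [show (fun t => ∫ x,
      (2⁻¹ * (torusVorticitySqAt (u t) x + ε ^ 2) ^ (-(1 : ℝ) / 2) *
          (∑ k, ∑ i, ∑ j, Torus.partialDeriv k (torusVorticityTensor (u t) i j) x ^ 2) -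
        4⁻¹ * (torusVorticitySqAt (u t) x + ε ^ 2) ^ (-(3 : ℝ) / 2) *
          ∑ k, Torus.partialDeriv k (torusVorticitySqAt (u t)) x ^ 2)) = Dis from (funext hDis).symm,
    ← hY 0, ← hY T]
  linarith

/-- **Constantin's direction-dissipation budget on `T³`, classical solutions, regularised form**
(Constantin 1990, §2: the balance (2.7) for `|ω|` with the direction-dissipation term `ν|ω||∇ξ|²`,
`|∇ω|² = |∇|ω||² + |ω|²|∇ξ|²`, integrated with the energy dissipation (2.21); Constantin 2003,
Thm 2: `ν∫₀ᵀ∫|ω||∇ξ|² ≤ ‖ω₀‖_{L¹} + (2ν)⁻¹‖u₀‖²_{L²}`). On `T^d`, `card d = 3`, along every classical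
solution of the unforced Navier–Stokes equations with `ν > 0` on `[0, T] × T^d`, `T > 0`, and for
every `ε > 0`, the regularised direction-dissipation density
`D_ε = ½(|ω|²+ε²)^{−1/2}∑ₖᵢⱼ(∂ₖWᵢⱼ)² − ¼(|ω|²+ε²)^{−3/2}∑ₖ(∂ₖ|ω|²)²`
(`= (|∇ω|²(|ω|²+ε²) − |ω|²|∇|ω||²)/(|ω|²+ε²)^{3/2} → |ω||∇ξ|²` on `{ω ≠ 0}` as `ε ↓ 0`; `≥ 0` by
`Torus.directionDissipationReg_nonneg`) satisfies

`ν ∫₀ᵀ ∫ D_ε dx dt ≤ ∫ (|ω₀|² + ε²)^{1/2} dx + ‖u₀‖₂²/(2ν)`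

(`‖u₀‖₂² = ∫‖u(0)‖²`; `∫(|ω₀|²+ε²)^{1/2} ≤ ‖ω₀‖₁ + ε`). Proof as printed: the weighted vorticity
balance for `Φ(y) = (y+ε²)^{1/2}` (its viscous term is exactly `−ν∫D_ε`), the stretching term
`∫σ(|ω|²+ε²)^{−1/2} ≤ ∫|S|_F|ω| ≤ ½(∫|S|²_F + ∫|ω|²) = (3/4)‖∇u‖₂²`, the fundamental theorem of
calculus and `∫₀ᵀ‖∇u‖₂² ≤ ‖u₀‖₂²/(2ν)`; no mean-zero or decay hypothesis. The `ε → 0` limit is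
`Torus.classicalNS_lintegral_directionDissipation_le`. [cite: Constantin1990, §2 (2.6)–(2.7), (2.21)] [cite: Constantin2003NearIdentity, §3 Thm 2] -/
theorem Torus.classicalNS_integral_directionDissipationReg_le (hd : Fintype.card d = 3) {ν T : ℝ}
    (hν : 0 < ν) (hT : 0 < T)
    {u : ℝ → UnitAddTorus d → EuclideanSpace ℝ d} {p : ℝ → UnitAddTorus d → ℝ}
    (h : Torus.IsClassicalNSSolutionOn (Icc 0 T) ν 0 u p) {ε : ℝ} (hε : 0 < ε) :
    ν * ∫ t in (0 : ℝ)..T, ∫ x,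
        (2⁻¹ * (torusVorticitySqAt (u t) x + ε ^ 2) ^ (-(1 : ℝ) / 2) *
            (∑ k, ∑ i, ∑ j, Torus.partialDeriv k (torusVorticityTensor (u t) i j) x ^ 2) -
          4⁻¹ * (torusVorticitySqAt (u t) x + ε ^ 2) ^ (-(3 : ℝ) / 2) *
            ∑ k, Torus.partialDeriv k (torusVorticitySqAt (u t)) x ^ 2) ≤
      (∫ x, (torusVorticitySqAt (u 0) x + ε ^ 2) ^ ((1 : ℝ) / 2)) + (∫ x, ‖u 0 x‖ ^ 2) / (2 * ν) := by
  have hm := Torus.master_directionDissipationReg₉ hd hν hT h hε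
  have hYT : 0 ≤ ∫ x, (torusVorticitySqAt (u T) x + ε ^ 2) ^ ((1 : ℝ) / 2) :=
    integral_nonneg fun x =>
      Real.rpow_nonneg (add_nonneg (torusVorticitySqAt_nonneg (u T) x) (sq_nonneg ε)) _
  have hE0 : 0 ≤ (∫ x, ‖u 0 x‖ ^ 2) / (2 * ν) := by positivity
  linarith

/-! ### The a priori `L¹` bound on the vorticity (Constantin 1990, Thm 2.1) -/

/-- **A priori bound on `‖ω(t)‖_{L¹}` (Constantin 1990, Thm 2.1, first assertion:
"`sup_{0≤t≤T} ∫|ω(x,t)|dx` is bounded in terms of the initial data and `F`" for classical periodic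
solutions; here `F = 0`).** On `T^d`, `card d = 3`, along every classical solution of the unforced
Navier–Stokes equations with `ν > 0` on `[0, T] × T^d`, for every `t ∈ [0, T]`,

`∫ |ω(t, x)| dx ≤ ∫ |ω(0, x)| dx + ‖u₀‖₂²/(2ν)`, `|ω| = (|ω|²)^{1/2}`, `‖u₀‖₂² = ∫‖u(0)‖²`

(the proof gives `(3/4)‖u₀‖₂²/(2ν)`). Proof as printed ((2.7)–(2.8) with the weight
`(|ω|²+ε²)^{1/2}`, (2.20)–(2.21)): `d/dt∫(|ω|²+ε²)^{1/2} ≤ ∫|S||ω| − ν∫D_ε ≤ (3/4)‖∇u‖₂²`, the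
energy budget, and `ε → 0`. [cite: Constantin1990, §2 Thm 2.1, (2.7)–(2.8), (2.20)–(2.21)] -/
theorem Torus.classicalNS_integral_vorticityAbs_le (hd : Fintype.card d = 3) {ν T : ℝ}
    (hν : 0 < ν) {u : ℝ → UnitAddTorus d → EuclideanSpace ℝ d} {p : ℝ → UnitAddTorus d → ℝ}
    (h : Torus.IsClassicalNSSolutionOn (Icc 0 T) ν 0 u p) {t : ℝ} (ht : t ∈ Icc 0 T) :
    ∫ x, torusVorticitySqAt (u t) x ^ ((1 : ℝ) / 2) ≤
      (∫ x, torusVorticitySqAt (u 0) x ^ ((1 : ℝ) / 2)) + (∫ x, ‖u 0 x‖ ^ 2) / (2 * ν) := by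
  have hE0 : 0 ≤ (∫ x, ‖u 0 x‖ ^ 2) / (2 * ν) := by positivity
  rcases ht.1.eq_or_lt with h0 | h0
  · rw [← h0]; linarith
  -- restrict to `[0, t]` and use the master inequality for every `ε > 0`
  have h' : Torus.IsClassicalNSSolutionOn (Icc 0 t) ν 0 u p :=
    h.mono (Icc_subset_Icc_right ht.2) (uniqueDiffOn_Icc h0)
  have hus : ∀ τ ∈ Icc 0 t, Torus.IsSmooth (u τ) := fun τ hτ => h'.smooth_velocity.isSmooth_slice hτ
  have hQt : Continuous (torusVorticitySqAt (u t)) := (isSmooth_Q₉ (hus t ⟨ht.1, le_rfl⟩)).continuous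
  have hQ0 : Continuous (torusVorticitySqAt (u 0)) := (isSmooth_Q₉ (hus 0 ⟨le_rfl, ht.1⟩)).continuous
  refine le_of_forall_pos_le_add fun ε hε => ?_
  have hm := Torus.master_directionDissipationReg₉ hd hν h0 h' hε
  -- the dissipation integral is nonnegative
  have hDis : 0 ≤ ∫ τ in (0 : ℝ)..t, ∫ x,
      (2⁻¹ * (torusVorticitySqAt (u τ) x + ε ^ 2) ^ (-(1 : ℝ) / 2) *
          (∑ k, ∑ i, ∑ j, Torus.partialDeriv k (torusVorticityTensor (u τ) i j) x ^ 2) -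
        4⁻¹ * (torusVorticitySqAt (u τ) x + ε ^ 2) ^ (-(3 : ℝ) / 2) *
          ∑ k, Torus.partialDeriv k (torusVorticitySqAt (u τ)) x ^ 2) := by
    refine intervalIntegral.integral_nonneg h0.le fun τ hτ => integral_nonneg fun x => ?_
    exact Torus.directionDissipationReg_nonneg (hus τ hτ) hε x
  -- `∫|ω(t)| ≤ ∫(|ω(t)|²+ε²)^{1/2}` and `∫(|ω₀|²+ε²)^{1/2} ≤ ∫|ω₀| + ε`
  have h1 : (∫ x, torusVorticitySqAt (u t) x ^ ((1 : ℝ) / 2)) ≤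
      ∫ x, (torusVorticitySqAt (u t) x + ε ^ 2) ^ ((1 : ℝ) / 2) := by
    refine integral_mono ((hQt.rpow_const fun x => Or.inr (by norm_num)).integrable_unitAddTorus)
      (((hQt.add continuous_const).rpow_const fun x => Or.inr (by norm_num)).integrable_unitAddTorus)
      fun x => ?_
    exact Real.rpow_le_rpow (torusVorticitySqAt_nonneg _ _) (by nlinarith [sq_nonneg ε]) (by norm_num)
  have h2 := integral_rpow_half_add_sq_le₉ hQ0 (fun x => torusVorticitySqAt_nonneg (u 0) x) hε
  nlinarith [hm, hDis, h1, h2, hν, hE0]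

/-! ### The limit `ε → 0`: Constantin's budget for `|ω||∇ξ|²` (lower Lebesgue integral) -/

/-- **Constantin's direction-dissipation budget on `T³`, classical solutions**
(Constantin 1990 §2 (2.7), (2.21); Constantin 2003 Thm 2:
`ν ∫₀ᵀ∫ |ω||∇ξ|² dx dt ≤ ‖ω₀‖_{L¹} + (2ν)⁻¹‖u₀‖²_{L²}`, `ξ = ω/|ω|`, the density set to `0`
where `ω = 0`). On `T^d`, `card d = 3`, along every classical solution of the unforced
Navier–Stokes equations with `ν > 0` on `[0, T] × T^d`, `T > 0`, the direction-dissipation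
density in the tree's orientation-free form,
`D₀ = ½|ω|^{−1}∑ₖᵢⱼ(∂ₖWᵢⱼ)² − ¼|ω|^{−3}∑ₖ(∂ₖ|ω|²)² = (|∇ω|² − |∇|ω||²)/|ω| = |ω||∇ξ|²` on
`{ω ≠ 0}` and `= 0` on `{ω = 0}` (there `∇|ω|² = 0`, and `0^{−1/2} = 0^{−3/2} = 0` in Lean),
has lower Lebesgue integral over `[0, T] × T^d`

`∫⁻ D₀ ≤ (‖ω₀‖₁ + ‖u₀‖₂²/(2ν)) / ν`, `‖ω₀‖₁ = ∫ |ω(0, x)| dx = ∫ (|ω(0,x)|²)^{1/2} dx`.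

Proof: Fatou's lemma along `ε = 1/(n+1) → 0` in the regularised budget
`Torus.classicalNS_integral_directionDissipationReg_le` (`D_ε → D₀` where `ω ≠ 0`, `D₀ = 0 ≤ D_ε`
where `ω = 0`; `∫(|ω₀|²+ε²)^{1/2} ≤ ‖ω₀‖₁ + ε`). Stated with `∫⁻` and `ENNReal.ofReal` because
the integrability of `D₀` is part of the conclusion, not a hypothesis.
[cite: Constantin1990, §2 (2.7), (2.21)] [cite: Constantin2003NearIdentity, §3 Thm 2] -/
theorem Torus.classicalNS_lintegral_directionDissipation_le (hd : Fintype.card d = 3) {ν T : ℝ}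
    (hν : 0 < ν) (hT : 0 < T)
    {u : ℝ → UnitAddTorus d → EuclideanSpace ℝ d} {p : ℝ → UnitAddTorus d → ℝ}
    (h : Torus.IsClassicalNSSolutionOn (Icc 0 T) ν 0 u p) :
    ∫⁻ z in Icc 0 T ×ˢ (univ : Set (UnitAddTorus d)), ENNReal.ofReal
        (2⁻¹ * torusVorticitySqAt (u z.1) z.2 ^ (-(1 : ℝ) / 2) *
            (∑ k, ∑ i, ∑ j, Torus.partialDeriv k (torusVorticityTensor (u z.1) i j) z.2 ^ 2) -
          4⁻¹ * torusVorticitySqAt (u z.1) z.2 ^ (-(3 : ℝ) / 2) *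
            ∑ k, Torus.partialDeriv k (torusVorticitySqAt (u z.1)) z.2 ^ 2) ≤
      ENNReal.ofReal (((∫ x, torusVorticitySqAt (u 0) x ^ ((1 : ℝ) / 2)) +
        (∫ x, ‖u 0 x‖ ^ 2) / (2 * ν)) / ν) := by
  -- the regularised densities along `εₙ = 1/(n+1)`
  set ε : ℕ → ℝ := fun n => 1 / ((n : ℝ) + 1) with hεdef
  have hεpos : ∀ n, 0 < ε n := fun n => by
    rw [hεdef]; dsimp only; positivity
  have hεlim : Tendsto ε atTop (𝓝 0) := tendsto_one_div_add_atTop_nhds_zero_nat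
  set G : ℝ → UnitAddTorus d → ℝ := fun τ x =>
    ∑ k, ∑ i, ∑ j, Torus.partialDeriv k (torusVorticityTensor (u τ) i j) x ^ 2 with hGdef
  set P : ℝ → UnitAddTorus d → ℝ := fun τ x =>
    ∑ k, Torus.partialDeriv k (torusVorticitySqAt (u τ)) x ^ 2 with hPdef
  set Q : ℝ → UnitAddTorus d → ℝ := fun τ x => torusVorticitySqAt (u τ) x with hQdef
  set D : ℕ → ℝ × UnitAddTorus d → ℝ := fun n z =>
    2⁻¹ * (Q z.1 z.2 + ε n ^ 2) ^ (-(1 : ℝ) / 2) * G z.1 z.2 -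
      4⁻¹ * (Q z.1 z.2 + ε n ^ 2) ^ (-(3 : ℝ) / 2) * P z.1 z.2 with hDdef
  set D₀ : ℝ × UnitAddTorus d → ℝ := fun z =>
    2⁻¹ * Q z.1 z.2 ^ (-(1 : ℝ) / 2) * G z.1 z.2 - 4⁻¹ * Q z.1 z.2 ^ (-(3 : ℝ) / 2) * P z.1 z.2
    with hD₀def
  set A : ℝ := ∫ x, torusVorticitySqAt (u 0) x ^ ((1 : ℝ) / 2) with hAdef
  set B : ℝ := (∫ x, ‖u 0 x‖ ^ 2) / (2 * ν) with hBdef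
  have hus : ∀ τ ∈ Icc 0 T, Torus.IsSmooth (u τ) := fun τ hτ => h.smooth_velocity.isSmooth_slice hτ
  have hG0 : ∀ z : ℝ × UnitAddTorus d, 0 ≤ G z.1 z.2 := fun z =>
    Finset.sum_nonneg fun k _ => Finset.sum_nonneg fun i _ => Finset.sum_nonneg fun j _ => sq_nonneg _
  have hQ0 : ∀ z : ℝ × UnitAddTorus d, 0 ≤ Q z.1 z.2 := fun z => torusVorticitySqAt_nonneg _ _
  have hB0 : 0 ≤ B := by positivity
  have hA0 : 0 ≤ A := integral_nonneg fun x => Real.rpow_nonneg (torusVorticitySqAt_nonneg _ _) _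
  show ∫⁻ z in Icc 0 T ×ˢ univ, ENNReal.ofReal (D₀ z) ≤ ENNReal.ofReal ((A + B) / ν)
  -- the product measure restricted to `[0, T] × T^d` is finite
  set μ : Measure (ℝ × UnitAddTorus d) := volume.restrict (Icc 0 T ×ˢ univ) with hμ
  have hμfin : volume (Icc (0 : ℝ) T ×ˢ (univ : Set (UnitAddTorus d))) ≠ ⊤ := by
    rw [Measure.volume_eq_prod, Measure.prod_prod, Real.volume_Icc, measure_univ, mul_one]
    exact ENNReal.ofReal_ne_top
  haveI : IsFiniteMeasure μ := isFiniteMeasure_restrict.2 hμfin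
  -- Step 1: measurability and integrability of the regularised densities on `[0, T] × T^d`
  have hcont : ∀ n, ContinuousOn (Torus.stLift fun τ x => D n (τ, x)) (Icc 0 T ×ˢ univ) :=
    fun n => continuousOn_stLift_D₉ hT h.smooth_velocity (hεpos n)
  have hmeasD : ∀ n, AEStronglyMeasurable (D n) μ := fun n => by
    have h1 : AEStronglyMeasurable (Torus.stLift fun τ x => D n (τ, x))
        (volume.restrict (Icc 0 T ×ˢ univ)) :=
      (hcont n).aestronglyMeasurable (measurableSet_Icc.prod MeasurableSet.univ)
    have h2 := Torus.aestronglyMeasurable_uncurry_of_stLift_restrict h1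
    exact h2
  have hbdd : ∀ n, ∃ C : ℝ, ∀ z ∈ Icc 0 T ×ˢ (univ : Set (UnitAddTorus d)), ‖D n z‖ ≤ C := by
    intro n
    obtain ⟨C, hC⟩ := Torus.exists_norm_le_of_continuousOn_of_isCompact (hcont n) isCompact_Icc
      subset_rfl
    exact ⟨C, fun z hz => hC z.1 (mem_prod.1 hz).1 z.2⟩
  have hint : ∀ n, Integrable (D n) μ := fun n => by
    obtain ⟨C, hC⟩ := hbdd n
    refine Integrable.of_bound (hmeasD n) C ?_
    rw [hμ]
    exact (ae_restrict_iff' (measurableSet_Icc.prod MeasurableSet.univ)).2 (ae_of_all _ hC)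
  have hDnn : ∀ n, ∀ z : ℝ × UnitAddTorus d, z ∈ Icc 0 T ×ˢ (univ : Set (UnitAddTorus d)) →
      0 ≤ D n z := fun n z hz =>
    Torus.directionDissipationReg_nonneg (hus z.1 (mem_prod.1 hz).1) (hεpos n) z.2
  -- Step 2: `∫⁻ D_εₙ = ofReal (∫₀ᵀ∫ D_εₙ) ≤ ofReal ((A + εₙ + B)/ν)`
  have hkey : ∀ n, ∫⁻ z, ENNReal.ofReal (D n z) ∂μ ≤ ENNReal.ofReal ((A + ε n + B) / ν) := by
    intro n
    have hnn : 0 ≤ᵐ[μ] D n := by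
      rw [hμ]
      exact (ae_restrict_iff' (measurableSet_Icc.prod MeasurableSet.univ)).2 (ae_of_all _ (hDnn n))
    rw [← ofReal_integral_eq_lintegral_ofReal (hint n) hnn]
    refine ENNReal.ofReal_le_ofReal ?_
    -- Fubini and the regularised budget
    have hprod : μ = (volume.restrict (Icc 0 T)).prod volume := by
      rw [hμ, Measure.volume_eq_prod, ← Measure.prod_restrict, Measure.restrict_univ]
    have hint' : Integrable (D n) ((volume.restrict (Icc 0 T)).prod volume) := hprod ▸ hint n
    have hF : ∫ z, D n z ∂μ = ∫ t in (0 : ℝ)..T, ∫ x, D n (t, x) := by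
      rw [hprod, integral_prod _ hint', intervalIntegral.integral_of_le hT.le,
        integral_Icc_eq_integral_Ioc]
    have hmain := Torus.classicalNS_integral_directionDissipationReg_le hd hν hT h (hεpos n)
    have hAε : (∫ x, (torusVorticitySqAt (u 0) x + ε n ^ 2) ^ ((1 : ℝ) / 2)) ≤ A + ε n :=
      integral_rpow_half_add_sq_le₉ (isSmooth_Q₉ (hus 0 ⟨le_rfl, hT.le⟩)).continuous
        (fun x => torusVorticitySqAt_nonneg (u 0) x) (hεpos n)
    rw [hF, le_div_iff₀ hν]
    have e : (∫ t in (0 : ℝ)..T, ∫ x, D n (t, x)) = ∫ t in (0 : ℝ)..T, ∫ x,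
        (2⁻¹ * (torusVorticitySqAt (u t) x + ε n ^ 2) ^ (-(1 : ℝ) / 2) *
            (∑ k, ∑ i, ∑ j, Torus.partialDeriv k (torusVorticityTensor (u t) i j) x ^ 2) -
          4⁻¹ * (torusVorticitySqAt (u t) x + ε n ^ 2) ^ (-(3 : ℝ) / 2) *
            ∑ k, Torus.partialDeriv k (torusVorticitySqAt (u t)) x ^ 2) := rfl
    rw [e]
    linarith
  -- Step 3: pointwise, `ofReal D₀ ≤ liminf ofReal D_εₙ`
  have hptw : ∀ z : ℝ × UnitAddTorus d,
      ENNReal.ofReal (D₀ z) ≤ liminf (fun n => ENNReal.ofReal (D n z)) atTop := by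
    intro z
    rcases (hQ0 z).eq_or_lt with hq | hq
    · -- `ω = 0`: `D₀ = 0`
      have : D₀ z = 0 := by
        rw [hD₀def]; dsimp only
        rw [← hq, Real.zero_rpow (by norm_num), Real.zero_rpow (by norm_num)]
        ring
      rw [this, ENNReal.ofReal_zero]
      exact bot_le
    · -- `ω ≠ 0`: `D_εₙ → D₀`
      have hlimQ : Tendsto (fun n => Q z.1 z.2 + ε n ^ 2) atTop (𝓝 (Q z.1 z.2)) := by
        have := (hεlim.pow 2).const_add (Q z.1 z.2)
        simpa using this
      have hlim : Tendsto (fun n => D n z) atTop (𝓝 (D₀ z)) := by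
        rw [hDdef, hD₀def]
        exact ((tendsto_const_nhds.mul (hlimQ.rpow_const (Or.inl hq.ne'))).mul
          tendsto_const_nhds).sub
          ((tendsto_const_nhds.mul (hlimQ.rpow_const (Or.inl hq.ne'))).mul tendsto_const_nhds)
      exact ((ENNReal.tendsto_ofReal hlim).liminf_eq).symm.le
  -- Step 4: Fatou
  have hmeas : ∀ n, AEMeasurable (fun z => ENNReal.ofReal (D n z)) μ :=
    fun n => (hmeasD n).aemeasurable.ennreal_ofReal
  have hblim : Tendsto (fun n => ENNReal.ofReal ((A + ε n + B) / ν)) atTop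
      (𝓝 (ENNReal.ofReal ((A + B) / ν))) := by
    refine ENNReal.tendsto_ofReal ?_
    have : Tendsto (fun n => (A + ε n + B) / ν) atTop (𝓝 ((A + 0 + B) / ν)) :=
      ((tendsto_const_nhds.add hεlim).add tendsto_const_nhds).div_const ν
    simpa using this
  calc ∫⁻ z, ENNReal.ofReal (D₀ z) ∂μ
      ≤ ∫⁻ z, liminf (fun n => ENNReal.ofReal (D n z)) atTop ∂μ := lintegral_mono fun z => hptw z
    _ ≤ liminf (fun n => ∫⁻ z, ENNReal.ofReal (D n z) ∂μ) atTop := lintegral_liminf_le' hmeas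
    _ ≤ liminf (fun n => ENNReal.ofReal ((A + ε n + B) / ν)) atTop :=
        liminf_le_liminf (Eventually.of_forall hkey)
    _ = ENNReal.ofReal ((A + B) / ν) := hblim.liminf_eq

/-! ### Constantin's `∇ω ∈ L^{4/(3+ε)}` budget (Thm 2.1, second assertion): the weighted step -/

/-- Real-analysis facts for Constantin's two-term weight `Φ(y) = (1+y)^{1/2} − κ(1+y)^β + κ`,
`β = (1−ε)/2`, `κβ = 1/4`, `0 < ε < 1`, at `y ≥ 0` (with `Φ' = ½(1+y)^{−1/2} − ¼(1+y)^{β−1}`,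
`Φ'' = −¼(1+y)^{−3/2} + ¼(1−β)(1+y)^{β−2}`): `0 ≤ Φ' ≤ ½(1+y)^{−1/2}`, `Φ'' ≤ 0`, and the
convexity-along-`ω` bound `Φ' + 2yΦ'' ≥ (ε/4)(1+y)^{β−1}` (Constantin 1990 (2.13)–(2.17)).
[cite: Constantin1990, §2 (2.13)–(2.17)] -/
private theorem weight_facts₉ {ε : ℝ} (hε : 0 < ε) (hε1 : ε ≤ 1) {y : ℝ} (hy : 0 ≤ y) :
    (0 ≤ 2⁻¹ * (1 + y) ^ (-(1 : ℝ) / 2) - 4⁻¹ * (1 + y) ^ ((1 - ε) / 2 - 1)) ∧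
    (2⁻¹ * (1 + y) ^ (-(1 : ℝ) / 2) - 4⁻¹ * (1 + y) ^ ((1 - ε) / 2 - 1) ≤
      2⁻¹ * (1 + y) ^ (-(1 : ℝ) / 2)) ∧
    (-(4⁻¹ * (1 + y) ^ (-(3 : ℝ) / 2)) + 4⁻¹ * (1 - (1 - ε) / 2) * (1 + y) ^ ((1 - ε) / 2 - 2) ≤ 0) ∧
    (ε / 4 * (1 + y) ^ ((1 - ε) / 2 - 1) ≤
      (2⁻¹ * (1 + y) ^ (-(1 : ℝ) / 2) - 4⁻¹ * (1 + y) ^ ((1 - ε) / 2 - 1)) +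
        2 * y * (-(4⁻¹ * (1 + y) ^ (-(3 : ℝ) / 2)) +
          4⁻¹ * (1 - (1 - ε) / 2) * (1 + y) ^ ((1 - ε) / 2 - 2))) := by
  set A : ℝ := 1 + y with hA
  have hA1 : 1 ≤ A := by rw [hA]; linarith
  have hA0 : 0 < A := by linarith
  -- monotonicity in the exponent (base `≥ 1`)
  have m1 : A ^ ((1 - ε) / 2 - 1) ≤ A ^ (-(1 : ℝ) / 2) :=
    Real.rpow_le_rpow_of_exponent_le hA1 (by linarith)
  have m2 : A ^ ((1 - ε) / 2 - 2) ≤ A ^ (-(3 : ℝ) / 2) :=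
    Real.rpow_le_rpow_of_exponent_le hA1 (by linarith)
  -- `A^{-1/2} = A^{-3/2} · A`, `A^{β-1} = A^{β-2} · A`
  have i1 : A ^ (-(1 : ℝ) / 2) = A ^ (-(3 : ℝ) / 2) * A := by
    rw [show -(1 : ℝ) / 2 = -(3 : ℝ) / 2 + 1 by norm_num, Real.rpow_add_one hA0.ne']
  have i2 : A ^ ((1 - ε) / 2 - 1) = A ^ ((1 - ε) / 2 - 2) * A := by
    rw [show (1 - ε) / 2 - 1 = (1 - ε) / 2 - 2 + 1 by ring, Real.rpow_add_one hA0.ne']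
  have p1 : 0 < A ^ (-(3 : ℝ) / 2) := Real.rpow_pos_of_pos hA0 _
  have p2 : 0 < A ^ ((1 - ε) / 2 - 2) := Real.rpow_pos_of_pos hA0 _
  have hy' : y = A - 1 := by rw [hA]; ring
  refine ⟨?_, ?_, ?_, ?_⟩
  · nlinarith [m1]
  · nlinarith [p2, i2]
  · nlinarith [m2, mul_nonneg (sub_nonneg.2 hε1) p2.le, mul_nonneg hε.le p2.le]
  · rw [i1, i2, hy']
    nlinarith [m2, p1, p2, mul_nonneg (sub_nonneg.2 hε1) p2.le, mul_nonneg hε.le p2.le]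

/-- `Φ(y) = (1+y)^{1/2} − κ(1+y)^β + κ ≥ 1` for `y ≥ 0` (`β = (1−ε)/2`, `κ = 1/(2(1−ε))`;
Bernoulli for the exponent `2β ≤ 1`), and `Φ(y) ≤ 1 + κ + y^{1/2}`. [folklore] -/
private theorem weight_bounds₉ {ε : ℝ} (hε : 0 < ε) (hε1 : ε < 1) {y : ℝ} (hy : 0 ≤ y) :
    1 ≤ (1 + y) ^ ((1 : ℝ) / 2) - 1 / (2 * (1 - ε)) * (1 + y) ^ ((1 - ε) / 2) + 1 / (2 * (1 - ε)) ∧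
    (1 + y) ^ ((1 : ℝ) / 2) - 1 / (2 * (1 - ε)) * (1 + y) ^ ((1 - ε) / 2) + 1 / (2 * (1 - ε)) ≤
      1 + 1 / (2 * (1 - ε)) + y ^ ((1 : ℝ) / 2) := by
  have h1ε : 0 < 1 - ε := by linarith
  set κ : ℝ := 1 / (2 * (1 - ε)) with hκ
  have hκ0 : 0 < κ := by rw [hκ]; positivity
  set s : ℝ := (1 + y) ^ ((1 : ℝ) / 2) with hs
  have hs1 : 1 ≤ s := by
    rw [hs]; exact Real.one_le_rpow (by linarith) (by norm_num)
  -- `(1+y)^β = s^{2β}`, `2β = 1 - ε`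
  have hpow : (1 + y) ^ ((1 - ε) / 2) = s ^ (1 - ε) := by
    rw [hs, ← Real.rpow_mul (by linarith)]
    congr 1; ring
  -- Bernoulli: `s^{1-ε} ≤ 1 + (1-ε)(s-1)`
  have hB : s ^ (1 - ε) ≤ 1 + (1 - ε) * (s - 1) := by
    have := rpow_one_add_le_one_add_mul_self (s := s - 1) (by linarith) (p := 1 - ε)
      h1ε.le (by linarith)
    simpa [add_sub_cancel] using this
  have hκB : κ * s ^ (1 - ε) ≤ κ + 2⁻¹ * (s - 1) := by
    have := mul_le_mul_of_nonneg_left hB hκ0.le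
    have e : κ * (1 - ε) = 2⁻¹ := by rw [hκ]; field_simp
    nlinarith [this, e]
  refine ⟨?_, ?_⟩
  · rw [hpow]; nlinarith [hκB, hs1]
  · -- `(1+y)^{1/2} ≤ 1 + y^{1/2}` and `κ (1+y)^β ≥ 0`
    have h2 : s ≤ 1 + y ^ ((1 : ℝ) / 2) := by
      rw [hs, ← Real.sqrt_eq_rpow, ← Real.sqrt_eq_rpow, Real.sqrt_le_left (by positivity)]
      nlinarith [Real.sq_sqrt hy, Real.sqrt_nonneg y]
    have h3 : 0 ≤ κ * (1 + y) ^ ((1 - ε) / 2) := mul_nonneg hκ0.le (Real.rpow_nonneg (by linarith) _)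
    linarith

/-- Joint continuity of the weighted gradient density `(1+|ω|²)^{−b} ∑ₖᵢⱼ(∂ₖWᵢⱼ)²` along a jointly
smooth `u` on `[0, T] × T^d`. [folklore] -/
private theorem continuousOn_stLift_weightedGradSq₉ {T : ℝ} (hT : 0 < T)
    {u : ℝ → UnitAddTorus d → EuclideanSpace ℝ d} (hu : Torus.IsSmoothSpaceTimeOn (Icc 0 T) u)
    (b : ℝ) :
    ContinuousOn (Torus.stLift fun τ x =>
      (1 + torusVorticitySqAt (u τ) x) ^ b *
        ∑ k, ∑ i, ∑ j, Torus.partialDeriv k (torusVorticityTensor (u τ) i j) x ^ 2) (Icc 0 T ×ˢ univ) := by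
  have hU : UniqueDiffOn ℝ (Icc 0 T) := uniqueDiffOn_Icc hT
  have hQst := isSmoothSpaceTimeOn_Q₉ hu hT
  have hWst := fun i j => isSmoothSpaceTimeOn_W₉ hu hT i j
  have cQst : ContinuousOn (Torus.stLift (fun s y => torusVorticitySqAt (u s) y)) (Icc 0 T ×ˢ univ) :=
    hQst.continuousOn_stLift
  have hApos : ∀ z ∈ Icc 0 T ×ˢ (univ : Set (EuclideanSpace ℝ d)),
      0 < 1 + Torus.stLift (fun s y => torusVorticitySqAt (u s) y) z := fun z _ => by
    have := torusVorticitySqAt_nonneg (u z.1) (Torus.proj z.2)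
    show 0 < 1 + torusVorticitySqAt (u z.1) (Torus.proj z.2)
    positivity
  have cdW : ∀ k i j, ContinuousOn (Torus.stLift (fun s y =>
      Torus.partialDeriv k (torusVorticityTensor (u s) i j) y)) (Icc 0 T ×ˢ univ) :=
    fun k i j => ((hWst i j).partialDeriv hU k).continuousOn_stLift
  have e' : Torus.stLift (fun τ x => (1 + torusVorticitySqAt (u τ) x) ^ b *
        ∑ k, ∑ i, ∑ j, Torus.partialDeriv k (torusVorticityTensor (u τ) i j) x ^ 2) =
      fun z => (1 + Torus.stLift (fun s y => torusVorticitySqAt (u s) y) z) ^ b *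
        ∑ k, ∑ i, ∑ j, Torus.stLift (fun s y =>
          Torus.partialDeriv k (torusVorticityTensor (u s) i j) y) z ^ 2 := rfl
  rw [e']
  exact ((continuousOn_const.add cQst).rpow_const fun z hz => Or.inl (hApos z hz).ne').mul
    (continuousOn_finsetSum _ fun k _ => continuousOn_finsetSum _ fun i _ =>
      continuousOn_finsetSum _ fun j _ => (cdW k i j).pow 2)

/-- Continuity of a slice of the weighted gradient density (`v` smooth). [folklore] -/
private theorem continuous_weightedGradSq₉ {v : UnitAddTorus d → EuclideanSpace ℝ d}
    (hv : Torus.IsSmooth v) (b : ℝ) :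
    Continuous fun x => (1 + torusVorticitySqAt v x) ^ b *
      ∑ k, ∑ i, ∑ j, Torus.partialDeriv k (torusVorticityTensor v i j) x ^ 2 := by
  have hQs : Torus.IsSmooth (torusVorticitySqAt v) := isSmooth_Q₉ hv
  have hA : ∀ x, 0 < 1 + torusVorticitySqAt v x := fun x => by
    have := torusVorticitySqAt_nonneg v x
    positivity
  exact ((continuous_const.add hQs.continuous).rpow_const fun x => Or.inl (hA x).ne').mul
    (continuous_finsetSum _ fun k _ => continuous_finsetSum _ fun i _ =>
      continuous_finsetSum _ fun j _ => ((isSmooth_W₉ hv i j).partialDeriv k).continuous.pow 2)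

/-- Pointwise viscous bound for the two-term weight: with `a = Φ'(Q)`, `b = Φ''(Q) ≤ 0`,
`P ≤ 2QG`: `aG + bP ≥ (a + 2Qb)G ≥ (ε/4)(1+Q)^{β−1}G`. [cite: Constantin1990, §2 (2.17)] -/
private theorem viscous_weight_ge₉ {v : UnitAddTorus d → EuclideanSpace ℝ d} (hv : Torus.IsSmooth v)
    {ε : ℝ} (hε : 0 < ε) (hε1 : ε ≤ 1) (x : UnitAddTorus d) :
    ε / 4 * ((1 + torusVorticitySqAt v x) ^ ((1 - ε) / 2 - 1) *
        ∑ k, ∑ i, ∑ j, Torus.partialDeriv k (torusVorticityTensor v i j) x ^ 2) ≤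
      (2⁻¹ * (1 + torusVorticitySqAt v x) ^ (-(1 : ℝ) / 2) -
          4⁻¹ * (1 + torusVorticitySqAt v x) ^ ((1 - ε) / 2 - 1)) *
        (∑ k, ∑ i, ∑ j, Torus.partialDeriv k (torusVorticityTensor v i j) x ^ 2) +
      (-(4⁻¹ * (1 + torusVorticitySqAt v x) ^ (-(3 : ℝ) / 2)) +
          4⁻¹ * (1 - (1 - ε) / 2) * (1 + torusVorticitySqAt v x) ^ ((1 - ε) / 2 - 2)) *
        ∑ k, Torus.partialDeriv k (torusVorticitySqAt v) x ^ 2 := by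
  have hq := torusVorticitySqAt_nonneg v x
  obtain ⟨_, _, f3, f4⟩ := weight_facts₉ hε hε1 hq
  have hPle := Torus.sum_sq_partialDeriv_torusVorticitySqAt_le hv x
  set Q := torusVorticitySqAt v x
  set G := ∑ k, ∑ i, ∑ j, Torus.partialDeriv k (torusVorticityTensor v i j) x ^ 2
  set P := ∑ k, Torus.partialDeriv k (torusVorticitySqAt v) x ^ 2
  have hG0 : 0 ≤ G := Finset.sum_nonneg fun k _ =>
    Finset.sum_nonneg fun i _ => Finset.sum_nonneg fun j _ => sq_nonneg _
  set a := 2⁻¹ * (1 + Q) ^ (-(1 : ℝ) / 2) - 4⁻¹ * (1 + Q) ^ ((1 - ε) / 2 - 1)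
  set b := -(4⁻¹ * (1 + Q) ^ (-(3 : ℝ) / 2)) + 4⁻¹ * (1 - (1 - ε) / 2) * (1 + Q) ^ ((1 - ε) / 2 - 2)
  have h1 : b * (2 * Q * G) ≤ b * P := mul_le_mul_of_nonpos_left hPle f3
  nlinarith [h1, mul_le_mul_of_nonneg_right f4 hG0]

/-- Pointwise stretching bound for the two-term weight (`card d = 3`, divergence-free):
`2Φ'(Q)σ ≤ (1+Q)^{−1/2}|σ| ≤ |S|_F Q (1+Q)^{−1/2} ≤ |S|_F |ω| ≤ ½(|S|²_F + |ω|²)`.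
[cite: Constantin1990, §2 (2.7), (2.11)–(2.12)] -/
private theorem stretching_weight_le₉ (hd : Fintype.card d = 3)
    {v : UnitAddTorus d → EuclideanSpace ℝ d} (hv : Torus.IsContDiff 1 v) (hdiv : Torus.IsDivFree v)
    {ε : ℝ} (hε : 0 < ε) (hε1 : ε ≤ 1) (x : UnitAddTorus d) :
    2 * ((2⁻¹ * (1 + torusVorticitySqAt v x) ^ (-(1 : ℝ) / 2) -
        4⁻¹ * (1 + torusVorticitySqAt v x) ^ ((1 - ε) / 2 - 1)) * torusStretchingDensity v x) ≤
      2⁻¹ * ((∑ i, ∑ j, ((Torus.partialDeriv j v x i + Torus.partialDeriv i v x j) / 2) ^ 2) +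
        torusVorticitySqAt v x) := by
  have hQ0 := torusVorticitySqAt_nonneg v x
  obtain ⟨f1, f2, _, _⟩ := weight_facts₉ hε hε1 hQ0
  have habs := abs_torusStretchingDensity_le₉ hd hv hdiv x
  set Q := torusVorticitySqAt v x
  set σ := torusStretchingDensity v x
  set sS := ∑ i, ∑ j, ((Torus.partialDeriv j v x i + Torus.partialDeriv i v x j) / 2) ^ 2
  have hs0 : 0 ≤ sS := Finset.sum_nonneg fun i _ => Finset.sum_nonneg fun j _ => sq_nonneg _
  have hA1 : 0 < 1 + Q := by linarith
  -- `(1+Q)^{-1/2} |σ| ≤ ½(sS + Q)`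
  have hr : (1 + Q) ^ (-(1 : ℝ) / 2) = (Real.sqrt (1 + Q))⁻¹ := by
    rw [Real.sqrt_eq_rpow, ← Real.rpow_neg hA1.le]; norm_num
  have hsq : 0 < Real.sqrt (1 + Q) := Real.sqrt_pos.2 hA1
  have hQA : Q * (Real.sqrt (1 + Q))⁻¹ ≤ Real.sqrt Q := by
    rw [mul_inv_le_iff₀ hsq]
    calc Q = Real.sqrt Q * Real.sqrt Q := (Real.mul_self_sqrt hQ0).symm
      _ ≤ Real.sqrt Q * Real.sqrt (1 + Q) :=
          mul_le_mul_of_nonneg_left (Real.sqrt_le_sqrt (by linarith)) (Real.sqrt_nonneg _)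
  have hamgm : Real.sqrt sS * Real.sqrt Q ≤ 2⁻¹ * (sS + Q) := by
    nlinarith [sq_nonneg (Real.sqrt sS - Real.sqrt Q), Real.sq_sqrt hs0, Real.sq_sqrt hQ0]
  have hσabs : (1 + Q) ^ (-(1 : ℝ) / 2) * |σ| ≤ 2⁻¹ * (sS + Q) := by
    rw [hr]
    calc (Real.sqrt (1 + Q))⁻¹ * |σ| ≤ (Real.sqrt (1 + Q))⁻¹ * (Real.sqrt sS * Q) :=
          mul_le_mul_of_nonneg_left habs (inv_nonneg.2 hsq.le)
      _ = Real.sqrt sS * (Q * (Real.sqrt (1 + Q))⁻¹) := by ring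
      _ ≤ Real.sqrt sS * Real.sqrt Q := mul_le_mul_of_nonneg_left hQA (Real.sqrt_nonneg _)
      _ ≤ 2⁻¹ * (sS + Q) := hamgm
  -- `2Φ'σ ≤ 2Φ'|σ| ≤ (1+Q)^{-1/2}|σ|`
  have hr0 : 0 ≤ (1 + Q) ^ (-(1 : ℝ) / 2) := Real.rpow_nonneg hA1.le _
  have key : (2⁻¹ * (1 + Q) ^ (-(1 : ℝ) / 2) - 4⁻¹ * (1 + Q) ^ ((1 - ε) / 2 - 1)) * σ ≤
      2⁻¹ * (1 + Q) ^ (-(1 : ℝ) / 2) * |σ| := by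
    rcases le_or_gt 0 σ with hσ | hσ
    · rw [abs_of_nonneg hσ]; nlinarith [f1, f2]
    · rw [abs_of_neg hσ]; nlinarith [f1, f2]
  nlinarith [key, hσabs, abs_nonneg σ]

/-- **Constantin's weighted vorticity-gradient budget on `T³`** (Constantin 1990, (2.20): the
space–time integral of `|∇ω|²(1+|ω|²)^{−(1+ε)/2}` is bounded a priori by the data, via the balance
(2.8)–(2.9) for `∫q(ω)` with the strictly convex, `√`-growth weight (2.13)–(2.17) and the energy
inequality (2.21)). On `T^d`, `card d = 3`, along every classical solution of the unforced
Navier–Stokes equations with `ν > 0` on `[0, T] × T^d`, `T > 0`, for every `0 < ε < 1` (printed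
range: `0 < ε ≤ ½`, p. 250 — the Lean range is strictly wider, same proof),

`(νε/4) ∫₀ᵀ ∫ (1+|ω|²)^{−(1+ε)/2} ∑ₖᵢⱼ(∂ₖWᵢⱼ)² dx dt ≤ 1 + 1/(2(1−ε)) + ∫|ω₀| + ‖u₀‖₂²/(2ν)`

(`∑ₖᵢⱼ(∂ₖWᵢⱼ)² = 2|∇ω|²`; `∫|ω₀| = ∫(|ω₀|²)^{1/2}`; the torus has measure `1`, whence the `1`).
Constants are those of this proof (weight `Φ(y) = (1+y)^{1/2} − κ(1+y)^{(1−ε)/2} + κ`, `κ = 1/(2(1−ε))`,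
`τ = 1` in (2.16)); the printed statement is "bounded in terms of the initial data".
[cite: Constantin1990, §2 Thm 2.1, (2.13)–(2.17), (2.20)–(2.21)] -/
theorem Torus.classicalNS_integral_weightedVorticityGradSq_le (hd : Fintype.card d = 3) {ν T : ℝ}
    (hν : 0 < ν) (hT : 0 < T)
    {u : ℝ → UnitAddTorus d → EuclideanSpace ℝ d} {p : ℝ → UnitAddTorus d → ℝ}
    (h : Torus.IsClassicalNSSolutionOn (Icc 0 T) ν 0 u p) {ε : ℝ} (hε : 0 < ε) (hε1 : ε < 1) :
    ν * ε / 4 * ∫ t in (0 : ℝ)..T, ∫ x,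
        (1 + torusVorticitySqAt (u t) x) ^ ((1 - ε) / 2 - 1) *
          ∑ k, ∑ i, ∑ j, Torus.partialDeriv k (torusVorticityTensor (u t) i j) x ^ 2 ≤
      1 + 1 / (2 * (1 - ε)) + (∫ x, torusVorticitySqAt (u 0) x ^ ((1 : ℝ) / 2)) +
        (∫ x, ‖u 0 x‖ ^ 2) / (2 * ν) := by
  have hU : UniqueDiffOn ℝ (Icc 0 T) := uniqueDiffOn_Icc hT
  have h1ε : 0 < 1 - ε := by linarith
  obtain ⟨β, hβ⟩ : ∃ β : ℝ, β = (1 - ε) / 2 := ⟨_, rfl⟩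
  obtain ⟨κ, hκ⟩ : ∃ κ : ℝ, κ = 1 / (2 * (1 - ε)) := ⟨_, rfl⟩
  have hκβ : κ * β = 4⁻¹ := by rw [hκ, hβ]; field_simp; ring
  -- the weight on `U = (−1, ∞)` and its derivatives
  set Φ : ℝ → ℝ := fun y => (1 + y) ^ ((1 : ℝ) / 2) - κ * (1 + y) ^ β + κ with hΦdef
  have hUo : IsOpen (Ioi (-1 : ℝ)) := isOpen_Ioi
  have hΦcd : ContDiffOn ℝ ((⊤ : ℕ∞) : WithTop ℕ∞) Φ (Ioi (-1)) := by
    have hb : ∀ r : ℝ, ContDiffOn ℝ ((⊤ : ℕ∞) : WithTop ℕ∞) (fun y : ℝ => (1 + y) ^ r) (Ioi (-1)) :=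
      fun r => (contDiffOn_const.add contDiffOn_id).rpow_const_of_ne fun y hy => by
        have : (-1 : ℝ) < y := hy
        simp only [id_eq]; linarith
    exact ((hb _).sub (contDiffOn_const.mul (hb _))).add contDiffOn_const
  have hmaps : ∀ s ∈ Icc 0 T, ∀ x, torusVorticitySqAt (u s) x ∈ Ioi (-1 : ℝ) := fun s _ x => by
    show (-1 : ℝ) < torusVorticitySqAt (u s) x
    linarith [torusVorticitySqAt_nonneg (u s) x]
  have hd1 : ∀ y : ℝ, -1 < y → deriv Φ y =
      2⁻¹ * (1 + y) ^ (-(1 : ℝ) / 2) - 4⁻¹ * (1 + y) ^ (β - 1) := by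
    intro y hy
    have hne : 1 + y ≠ 0 := by
      intro h0; linarith
    have ha := ((hasDerivAt_id' y).const_add 1).rpow_const (p := (1 : ℝ) / 2) (Or.inl hne)
    have hb := (((hasDerivAt_id' y).const_add 1).rpow_const (p := β) (Or.inl hne)).const_mul κ
    have hΦ' : HasDerivAt Φ (1 * ((1 : ℝ) / 2) * (1 + y) ^ ((1 : ℝ) / 2 - 1) -
        κ * (1 * β * (1 + y) ^ (β - 1))) y := (ha.sub hb).add_const κ
    rw [hΦ'.deriv, show (1 : ℝ) / 2 - 1 = -(1 : ℝ) / 2 by norm_num]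
    have e : κ * (1 * β * (1 + y) ^ (β - 1)) = κ * β * (1 + y) ^ (β - 1) := by ring
    rw [e, hκβ]; ring
  have hd2 : ∀ y : ℝ, -1 < y → deriv (deriv Φ) y =
      -(4⁻¹ * (1 + y) ^ (-(3 : ℝ) / 2)) + 4⁻¹ * (1 - β) * (1 + y) ^ (β - 2) := by
    intro y hy
    have hne : 1 + y ≠ 0 := by
      intro h0; linarith
    have hloc : deriv Φ =ᶠ[𝓝 y] fun z => 2⁻¹ * (1 + z) ^ (-(1 : ℝ) / 2) - 4⁻¹ * (1 + z) ^ (β - 1) := by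
      filter_upwards [Ioi_mem_nhds hy] with z hz using hd1 z hz
    rw [hloc.deriv_eq]
    have ha := (((hasDerivAt_id' y).const_add 1).rpow_const (p := -(1 : ℝ) / 2) (Or.inl hne)).const_mul
      (2⁻¹ : ℝ)
    have hb := (((hasDerivAt_id' y).const_add 1).rpow_const (p := β - 1) (Or.inl hne)).const_mul
      (4⁻¹ : ℝ)
    have hd : HasDerivAt (fun z : ℝ => 2⁻¹ * (1 + z) ^ (-(1 : ℝ) / 2) - 4⁻¹ * (1 + z) ^ (β - 1))
        (2⁻¹ * (1 * (-(1 : ℝ) / 2) * (1 + y) ^ (-(1 : ℝ) / 2 - 1)) -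
          4⁻¹ * (1 * (β - 1) * (1 + y) ^ (β - 1 - 1))) y := ha.sub hb
    rw [hd.deriv, show -(1 : ℝ) / 2 - 1 = -(3 : ℝ) / 2 by norm_num,
      show β - 1 - 1 = β - 2 by ring]
    ring
  -- abbreviations
  obtain ⟨Y, hY⟩ : ∃ Y : ℝ → ℝ, ∀ τ, Y τ = ∫ x, Φ (torusVorticitySqAt (u τ) x) := ⟨_, fun _ => rfl⟩
  obtain ⟨Dis, hDis⟩ : ∃ Dis : ℝ → ℝ, ∀ τ, Dis τ = ∫ x,
      (1 + torusVorticitySqAt (u τ) x) ^ ((1 - ε) / 2 - 1) *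
        ∑ k, ∑ i, ∑ j, Torus.partialDeriv k (torusVorticityTensor (u τ) i j) x ^ 2 := ⟨_, fun _ => rfl⟩
  obtain ⟨g, hg⟩ : ∃ g : ℝ → ℝ, ∀ τ, g τ = Torus.gradNormSq (u τ) := ⟨_, fun _ => rfl⟩
  have hus : ∀ τ ∈ Icc 0 T, Torus.IsSmooth (u τ) := fun τ hτ => h.smooth_velocity.isSmooth_slice hτ
  have hΦc : Continuous (fun y : ℝ => Φ (max y 0)) := by
    have hm : Continuous fun y : ℝ => max y 0 := continuous_id.max continuous_const
    have h1 : ∀ y : ℝ, (1 + max y 0 : ℝ) ≠ 0 := fun y =>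
      (by linarith [le_max_right y 0] : (0 : ℝ) < 1 + max y 0).ne'
    rw [hΦdef]
    exact (((continuous_const.add hm).rpow_const fun y => Or.inl (h1 y)).sub
      (continuous_const.mul ((continuous_const.add hm).rpow_const fun y => Or.inl (h1 y)))).add
      continuous_const
  have hΦQ : ∀ {v : UnitAddTorus d → EuclideanSpace ℝ d}, Torus.IsSmooth v →
      Continuous fun x => Φ (torusVorticitySqAt v x) := by
    intro v hv
    have := hΦc.comp (isSmooth_Q₉ hv).continuous
    refine this.congr fun x => ?_
    simp [max_eq_left (torusVorticitySqAt_nonneg v x)]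
  -- Step 1: derivative of `Y` within `[0, T]` and its bound
  have hstep : ∀ t ∈ Icc 0 T, ∃ D : ℝ, HasDerivWithinAt Y D (Icc 0 T) t ∧
      D ≤ 3 / 4 * g t - ν * ε / 4 * Dis t := by
    intro t ht
    have hD := h.hasDerivWithinAt_integral_comp_torusVorticitySqAt hT hUo hΦcd hmaps ht
    rw [show (fun s => ∫ x, Φ (torusVorticitySqAt (u s) x)) = Y from (funext hY).symm] at hD
    refine ⟨_, hD, ?_⟩
    have hut : Torus.IsSmooth (u t) := hus t ht
    have hu1 : Torus.IsContDiff 1 (u t) := hut.isContDiff (by simp)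
    have hdivt : Torus.IsDivFree (u t) := h.divFree t ht
    have hQs : Torus.IsSmooth (torusVorticitySqAt (u t)) := isSmooth_Q₉ hut
    have hWs : ∀ i j, Torus.IsSmooth (torusVorticityTensor (u t) i j) := fun i j => isSmooth_W₉ hut i j
    have hA : ∀ x, 0 < 1 + torusVorticitySqAt (u t) x := fun x => by
      linarith [torusVorticitySqAt_nonneg (u t) x]
    have cQ : Continuous (torusVorticitySqAt (u t)) := hQs.continuous
    have cpow : ∀ r : ℝ, Continuous (fun x => (1 + torusVorticitySqAt (u t) x) ^ r) := fun r =>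
      (continuous_const.add cQ).rpow_const fun x => Or.inl (hA x).ne'
    have cG : Continuous (fun x => ∑ k, ∑ i, ∑ j,
        Torus.partialDeriv k (torusVorticityTensor (u t) i j) x ^ 2) :=
      continuous_finsetSum _ fun k _ => continuous_finsetSum _ fun i _ =>
        continuous_finsetSum _ fun j _ => ((hWs i j).partialDeriv k).continuous.pow 2
    have cP : Continuous (fun x => ∑ k, Torus.partialDeriv k (torusVorticitySqAt (u t)) x ^ 2) :=
      continuous_finsetSum _ fun k _ => (hQs.partialDeriv k).continuous.pow 2
    have cσ : Continuous (torusStretchingDensity (u t)) := by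
      have hD' : ∀ i k, Continuous (fun y => Torus.partialDeriv i (u t) y k) :=
        fun i k => ((hut.partialDeriv i).apply k).continuous
      have : Continuous (fun x => -∑ i, ∑ j, torusVorticityTensor (u t) i j x *
          ∑ k, Torus.partialDeriv i (u t) x k * Torus.partialDeriv k (u t) x j) :=
        (continuous_finsetSum _ fun i _ => continuous_finsetSum _ fun j _ =>
          (hWs i j).continuous.mul (continuous_finsetSum _ fun k _ => (hD' i k).mul (hD' k j))).neg
      exact this
    have cS : Continuous (fun x => ∑ i, ∑ j,
        ((Torus.partialDeriv j (u t) x i + Torus.partialDeriv i (u t) x j) / 2) ^ 2) := by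
      have hD' : ∀ i k, Continuous (fun y => Torus.partialDeriv i (u t) y k) :=
        fun i k => ((hut.partialDeriv i).apply k).continuous
      exact continuous_finsetSum _ fun i _ => continuous_finsetSum _ fun j _ =>
        (((hD' j i).add (hD' i j)).div_const _).pow 2
    have cΦ1 : Continuous (fun x => deriv Φ (torusVorticitySqAt (u t) x)) := by
      have hc : Continuous (fun x => 2⁻¹ * (1 + torusVorticitySqAt (u t) x) ^ (-(1 : ℝ) / 2) -
          4⁻¹ * (1 + torusVorticitySqAt (u t) x) ^ (β - 1)) :=
        (continuous_const.mul (cpow _)).sub (continuous_const.mul (cpow _))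
      exact hc.congr fun x => (hd1 _ (hmaps t ht x)).symm
    have cΦ2 : Continuous (fun x => deriv (deriv Φ) (torusVorticitySqAt (u t) x)) := by
      have hc : Continuous (fun x => -(4⁻¹ * (1 + torusVorticitySqAt (u t) x) ^ (-(3 : ℝ) / 2)) +
          4⁻¹ * (1 - β) * (1 + torusVorticitySqAt (u t) x) ^ (β - 2)) :=
        (continuous_const.mul (cpow _)).neg.add (continuous_const.mul (cpow _))
      exact hc.congr fun x => (hd2 _ (hmaps t ht x)).symm
    -- (a) the forcing term vanishes
    have e0 : (∫ x, deriv Φ (torusVorticitySqAt (u t) x) * ∑ i, ∑ j, torusVorticityTensor (u t) i j x *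
        (Torus.partialDeriv i ((0 : ℝ → UnitAddTorus d → EuclideanSpace ℝ d) t) x j -
          Torus.partialDeriv j ((0 : ℝ → UnitAddTorus d → EuclideanSpace ℝ d) t) x i)) = 0 := by
      have hz : ∀ i x, Torus.partialDeriv i (0 : UnitAddTorus d → EuclideanSpace ℝ d) x = 0 := by
        intro i x
        simp [Torus.partialDeriv, Torus.lineDeriv]
      simp [hz]
    -- (b) the viscous term dominates `(ε/4) Dis`
    have e1 : ε / 4 * Dis t ≤ (∫ x, deriv Φ (torusVorticitySqAt (u t) x) * ∑ k, ∑ i, ∑ j,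
          Torus.partialDeriv k (torusVorticityTensor (u t) i j) x ^ 2) +
        (∫ x, deriv (deriv Φ) (torusVorticitySqAt (u t) x) *
          ∑ k, Torus.partialDeriv k (torusVorticitySqAt (u t)) x ^ 2) := by
      have iA : Integrable (fun x => deriv Φ (torusVorticitySqAt (u t) x) * ∑ k, ∑ i, ∑ j,
          Torus.partialDeriv k (torusVorticityTensor (u t) i j) x ^ 2) :=
        (cΦ1.mul cG).integrable_unitAddTorus
      have iB : Integrable (fun x => deriv (deriv Φ) (torusVorticitySqAt (u t) x) *
          ∑ k, Torus.partialDeriv k (torusVorticitySqAt (u t)) x ^ 2) :=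
        (cΦ2.mul cP).integrable_unitAddTorus
      have i0 : Integrable (fun x => ε / 4 * ((1 + torusVorticitySqAt (u t) x) ^ ((1 - ε) / 2 - 1) *
          ∑ k, ∑ i, ∑ j, Torus.partialDeriv k (torusVorticityTensor (u t) i j) x ^ 2)) :=
        (continuous_const.mul ((cpow _).mul cG)).integrable_unitAddTorus
      rw [hDis t, ← MeasureTheory.integral_const_mul, ← integral_add iA iB]
      refine integral_mono i0 (iA.add iB) fun x => ?_
      dsimp only
      rw [hd1 _ (hmaps t ht x), hd2 _ (hmaps t ht x), hβ]
      exact viscous_weight_ge₉ hut hε hε1.le x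
    -- (c) the stretching term is at most `(3/4)‖∇u‖₂²`
    have e2 : 2 * (∫ x, deriv Φ (torusVorticitySqAt (u t) x) * torusStretchingDensity (u t) x) ≤
        3 / 4 * g t := by
      have hpt : ∀ x, 2 * (deriv Φ (torusVorticitySqAt (u t) x) * torusStretchingDensity (u t) x) ≤
          2⁻¹ * ((∑ i, ∑ j, ((Torus.partialDeriv j (u t) x i + Torus.partialDeriv i (u t) x j) / 2) ^ 2) +
            torusVorticitySqAt (u t) x) := by
        intro x
        rw [hd1 _ (hmaps t ht x), hβ]
        exact stretching_weight_le₉ hd hu1 hdivt hε hε1.le x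
      have iL : Integrable (fun x => 2 * (deriv Φ (torusVorticitySqAt (u t) x) *
          torusStretchingDensity (u t) x)) := (continuous_const.mul (cΦ1.mul cσ)).integrable_unitAddTorus
      have iR : Integrable (fun x => 2⁻¹ * ((∑ i, ∑ j,
          ((Torus.partialDeriv j (u t) x i + Torus.partialDeriv i (u t) x j) / 2) ^ 2) +
            torusVorticitySqAt (u t) x)) := (continuous_const.mul (cS.add cQ)).integrable_unitAddTorus
      have hmono := integral_mono iL iR hpt
      rw [MeasureTheory.integral_const_mul, MeasureTheory.integral_const_mul,
        integral_add cS.integrable_unitAddTorus cQ.integrable_unitAddTorus,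
        integral_strainNormSq_eq_torusEnstrophy hut hdivt,
        integral_torusVorticitySqAt_eq_two_mul_torusEnstrophy hut hdivt, torusEnstrophy, ← hg t] at hmono
      linarith
    -- assemble
    rw [e0, add_zero]
    nlinarith [e2, e1, hν]
  -- Step 2: continuity in time
  have hQst := isSmoothSpaceTimeOn_Q₉ h.smooth_velocity hT
  have cQst : ContinuousOn (Torus.stLift (fun s y => torusVorticitySqAt (u s) y)) (Icc 0 T ×ˢ univ) :=
    hQst.continuousOn_stLift
  have hYc : ContinuousOn Y (Icc 0 T) := by
    rw [show Y = fun τ => ∫ x, Φ (torusVorticitySqAt (u τ) x) from funext hY]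
    refine continuousOn_integral_of_continuousOn_stLift₉
      (φ := fun τ x => Φ (torusVorticitySqAt (u τ) x)) ?_ fun τ hτ => hΦQ (hus τ hτ)
    have e' : Torus.stLift (fun τ x => Φ (torusVorticitySqAt (u τ) x)) =
        fun z => (fun y : ℝ => Φ (max y 0)) (Torus.stLift (fun s y => torusVorticitySqAt (u s) y) z) := by
      funext z
      simp [Torus.stLift, max_eq_left (torusVorticitySqAt_nonneg _ _)]
    rw [e']
    exact hΦc.comp_continuousOn cQst
  have hDisc : ContinuousOn Dis (Icc 0 T) := by
    rw [show Dis = fun τ => ∫ x, (1 + torusVorticitySqAt (u τ) x) ^ ((1 - ε) / 2 - 1) *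
        ∑ k, ∑ i, ∑ j, Torus.partialDeriv k (torusVorticityTensor (u τ) i j) x ^ 2 from funext hDis]
    exact continuousOn_integral_of_continuousOn_stLift₉
      (continuousOn_stLift_weightedGradSq₉ hT h.smooth_velocity _)
      fun τ hτ => continuous_weightedGradSq₉ (hus τ hτ) _
  have hgc : ContinuousOn g (Icc 0 T) := by
    rw [show g = fun τ => Torus.gradNormSq (u τ) from funext hg]
    intro t ht
    have h1 : ContinuousWithinAt (fun s => (2 : ℝ) * (2⁻¹ * Torus.gradNormSq (u s))) (Icc 0 T) t :=
      continuousWithinAt_const.mul (h.hasDerivWithinAt_half_gradNormSq hT ht).continuousWithinAt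
    refine h1.congr (fun s _ => ?_) ?_ <;> ring
  -- Step 3: fundamental theorem of calculus on `[0, T]`
  choose! D hD using hstep
  have hφc : ContinuousOn (fun τ => 3 / 4 * g τ - ν * ε / 4 * Dis τ) (Icc 0 T) :=
    (continuousOn_const.mul hgc).sub (continuousOn_const.mul hDisc)
  have hFTC := intervalIntegral.sub_le_integral_of_hasDeriv_right_of_le hT.le hYc
    (fun τ hτ => ((hD τ ⟨hτ.1.le, hτ.2.le⟩).1).mono_of_mem_nhdsWithin
      (mem_nhdsWithin_of_mem_nhds (Icc_mem_nhds hτ.1 hτ.2)))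
    (hφc.integrableOn_compact isCompact_Icc) (fun τ hτ => (hD τ ⟨hτ.1.le, hτ.2.le⟩).2)
  have huIcc : uIcc 0 T = Icc 0 T := uIcc_of_le hT.le
  have hgi : IntervalIntegrable g volume 0 T := (hgc.mono (by rw [huIcc])).intervalIntegrable
  have hDi : IntervalIntegrable Dis volume 0 T := (hDisc.mono (by rw [huIcc])).intervalIntegrable
  rw [intervalIntegral.integral_sub (hgi.const_mul _) (hDi.const_mul _),
    intervalIntegral.integral_const_mul, intervalIntegral.integral_const_mul] at hFTC
  -- Step 4: energy budget, `Y(T) ≥ 0`, `Y(0) ≤ 1 + κ + ∫|ω₀|`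
  have hG := Torus.classicalNS_integral_gradNormSq_le hν hT h
  rw [show (fun t => Torus.gradNormSq (u t)) = g from (funext hg).symm] at hG
  have hYT : 0 ≤ Y T := by
    rw [hY]
    exact integral_nonneg fun x => by
      have hb := (weight_bounds₉ hε hε1 (torusVorticitySqAt_nonneg (u T) x)).1
      show (0 : ℝ) ≤ Φ (torusVorticitySqAt (u T) x)
      simp only [hΦdef, hκ, hβ] at hb ⊢
      linarith
  have hY0 : Y 0 ≤ 1 + κ + ∫ x, torusVorticitySqAt (u 0) x ^ ((1 : ℝ) / 2) := by
    rw [hY]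
    have hu0 := hus 0 ⟨le_rfl, hT.le⟩
    have i2 : Integrable (fun x => 1 + κ + torusVorticitySqAt (u 0) x ^ ((1 : ℝ) / 2)) :=
      (continuous_const.add ((isSmooth_Q₉ hu0).continuous.rpow_const
        fun x => Or.inr (by norm_num))).integrable_unitAddTorus
    calc (∫ x, Φ (torusVorticitySqAt (u 0) x))
        ≤ ∫ x, (1 + κ + torusVorticitySqAt (u 0) x ^ ((1 : ℝ) / 2)) :=
          integral_mono (hΦQ hu0).integrable_unitAddTorus i2 fun x => by
            have hb := (weight_bounds₉ hε hε1 (torusVorticitySqAt_nonneg (u 0) x)).2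
            show Φ (torusVorticitySqAt (u 0) x) ≤ _
            simp only [hΦdef, hκ, hβ] at hb ⊢
            linarith
      _ = 1 + κ + ∫ x, torusVorticitySqAt (u 0) x ^ ((1 : ℝ) / 2) := by
          rw [integral_add (integrable_const _) ((isSmooth_Q₉ hu0).continuous.rpow_const
            fun x => Or.inr (by norm_num)).integrable_unitAddTorus]
          simp
  -- conclusion
  rw [show (fun t => ∫ x, (1 + torusVorticitySqAt (u t) x) ^ ((1 - ε) / 2 - 1) *
      ∑ k, ∑ i, ∑ j, Torus.partialDeriv k (torusVorticityTensor (u t) i j) x ^ 2) = Dis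
      from (funext hDis).symm]
  have hE0 : 0 ≤ (∫ x, ‖u 0 x‖ ^ 2) / (2 * ν) := by positivity
  linarith [hFTC, hG, hYT, hY0, hκ, hE0]

/-! ### Constantin's `∇ω ∈ L^{4/(3+ε)}` budget (Thm 2.1, second assertion): the Hölder step -/

omit [DecidableEq d] in
/-- Hölder for continuous nonnegative functions on `T^d` with real conjugate exponents. [folklore] -/
private theorem integral_mul_le_rpow₉ {f g : UnitAddTorus d → ℝ} (hf : Continuous f)
    (hg : Continuous g) (hf0 : ∀ x, 0 ≤ f x) (hg0 : ∀ x, 0 ≤ g x) {p q : ℝ}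
    (hpq : p.HolderConjugate q) :
    ∫ x, f x * g x ≤ (∫ x, f x ^ p) ^ (1 / p) * (∫ x, g x ^ q) ^ (1 / q) :=
  integral_mul_le_Lp_mul_Lq_of_nonneg (μ := volume) hpq (ae_of_all _ hf0) (ae_of_all _ hg0)
    (hf.memLp_of_hasCompactSupport (HasCompactSupport.of_compactSpace f))
    (hg.memLp_of_hasCompactSupport (HasCompactSupport.of_compactSpace g))

omit [Fintype d] [DecidableEq d] in
/-- Hölder on `[0, T]` for functions continuous on `[0, T]` and nonnegative there, with real
conjugate exponents. [folklore] -/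
private theorem intervalIntegral_mul_le_rpow₉ {f g : ℝ → ℝ} {T : ℝ} (hT : 0 ≤ T)
    (hf : ContinuousOn f (Icc 0 T)) (hg : ContinuousOn g (Icc 0 T))
    (hf0 : ∀ t ∈ Icc 0 T, 0 ≤ f t) (hg0 : ∀ t ∈ Icc 0 T, 0 ≤ g t) {p q : ℝ}
    (hpq : p.HolderConjugate q) :
    ∫ t in (0 : ℝ)..T, f t * g t ≤
      (∫ t in (0 : ℝ)..T, f t ^ p) ^ (1 / p) * (∫ t in (0 : ℝ)..T, g t ^ q) ^ (1 / q) := by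
  simp only [intervalIntegral.integral_of_le hT]
  have hae : ∀ {φ : ℝ → ℝ}, (∀ t ∈ Icc 0 T, 0 ≤ φ t) → 0 ≤ᵐ[volume.restrict (Ioc 0 T)] φ :=
    fun h0 => (ae_restrict_iff' measurableSet_Ioc).2 (ae_of_all _ fun t ht => h0 t (Ioc_subset_Icc_self ht))
  have hmem : ∀ {φ : ℝ → ℝ}, ContinuousOn φ (Icc 0 T) → ∀ r : ℝ≥0∞,
      MemLp φ r (volume.restrict (Ioc 0 T)) := by
    intro φ hφ r
    have hm : AEStronglyMeasurable φ (volume.restrict (Ioc 0 T)) :=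
      (hφ.mono Ioc_subset_Icc_self).aestronglyMeasurable measurableSet_Ioc
    obtain ⟨C, hC⟩ := isCompact_Icc.exists_bound_of_continuousOn hφ
    exact (memLp_top_of_bound hm C ((ae_restrict_iff' measurableSet_Ioc).2
      (ae_of_all _ fun t ht => hC t (Ioc_subset_Icc_self ht)))).mono_exponent le_top
  exact integral_mul_le_Lp_mul_Lq_of_nonneg hpq (hae hf0) (hae hg0) (hmem hf _) (hmem hg _)

/-- **Constantin's a priori bound `∇ω ∈ L^{4/(3+ε)}` on `T³`** (Constantin 1990, Thm 2.1, second
assertion: "`∫₀ᵀ∫|∇ω|^{4/(3+ε)}dx ds` is bounded in terms of the initial data and `F`", obtained from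
(2.20) by the Hölder step (2.22); here `F = 0`). On `T^d`, `card d = 3`, along every classical
solution of the unforced Navier–Stokes equations with `ν > 0` on `[0, T] × T^d`, `T > 0`, for every
`0 < ε < 1` (printed range: `0 < ε ≤ ½`, p. 250 — the Lean range is strictly wider, same proof), with
`G := ∑ₖᵢⱼ(∂ₖWᵢⱼ)² = 2|∇ω|²` (so `G^{2/(3+ε)} = 2^{2/(3+ε)}|∇ω|^{4/(3+ε)}`):

`∫₀ᵀ ∫ G^{2/(3+ε)} dx dt ≤ (4M/(νε))^{2/(3+ε)} · (T + ‖u₀‖₂²/(2ν))^{(1+ε)/(3+ε)}`,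
`M := 1 + 1/(2(1−ε)) + ∫|ω₀| + ‖u₀‖₂²/(2ν)`

(Hölder with exponents `(3+ε)/2`, `(3+ε)/(1+ε)` against the weight `(1+|ω|²)^{(1+ε)/(3+ε)}`, in
`x` and then in `t`, using `Torus.classicalNS_integral_weightedVorticityGradSq_le` and
`∫₀ᵀ∫(1+|ω|²) = T + ∫₀ᵀ‖∇u‖₂² ≤ T + ‖u₀‖₂²/(2ν)`). Constants are those of this proof; the printed
statement is qualitative. [cite: Constantin1990, §2 Thm 2.1, (2.20)–(2.22)] -/
theorem Torus.classicalNS_integral_vorticityGradSq_rpow_le (hd : Fintype.card d = 3) {ν T : ℝ}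
    (hν : 0 < ν) (hT : 0 < T)
    {u : ℝ → UnitAddTorus d → EuclideanSpace ℝ d} {p : ℝ → UnitAddTorus d → ℝ}
    (h : Torus.IsClassicalNSSolutionOn (Icc 0 T) ν 0 u p) {ε : ℝ} (hε : 0 < ε) (hε1 : ε < 1) :
    ∫ t in (0 : ℝ)..T, ∫ x,
        (∑ k, ∑ i, ∑ j, Torus.partialDeriv k (torusVorticityTensor (u t) i j) x ^ 2) ^ (2 / (3 + ε)) ≤
      (4 * (1 + 1 / (2 * (1 - ε)) + (∫ x, torusVorticitySqAt (u 0) x ^ ((1 : ℝ) / 2)) +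
          (∫ x, ‖u 0 x‖ ^ 2) / (2 * ν)) / (ν * ε)) ^ (2 / (3 + ε)) *
        (T + (∫ x, ‖u 0 x‖ ^ 2) / (2 * ν)) ^ ((1 + ε) / (3 + ε)) := by
  -- exponents
  set a : ℝ := 2 / (3 + ε) with ha
  set b : ℝ := (1 + ε) / 2 with hb
  have h3ε : 0 < 3 + ε := by linarith
  have ha0 : 0 < a := by rw [ha]; positivity
  have ha1 : a < 1 := by rw [ha, div_lt_one h3ε]; linarith
  have hab : a * b = (1 + ε) / (3 + ε) := by rw [ha, hb]; field_simp
  have h1a : 1 - a = (1 + ε) / (3 + ε) := by rw [ha]; field_simp; ring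
  have hpq : (1 / a).HolderConjugate (1 / (1 - a)) := by
    refine Real.holderConjugate_iff.2 ⟨?_, ?_⟩
    · rw [lt_div_iff₀ ha0]; linarith
    · field_simp
      ring
  have hexp : (1 - ε) / 2 - 1 = -b := by rw [hb]; ring
  -- names
  obtain ⟨G, hG⟩ : ∃ G : ℝ → UnitAddTorus d → ℝ, ∀ τ x, G τ x =
      ∑ k, ∑ i, ∑ j, Torus.partialDeriv k (torusVorticityTensor (u τ) i j) x ^ 2 := ⟨_, fun _ _ => rfl⟩
  obtain ⟨Q, hQ⟩ : ∃ Q : ℝ → UnitAddTorus d → ℝ, ∀ τ x, Q τ x = torusVorticitySqAt (u τ) x :=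
    ⟨_, fun _ _ => rfl⟩
  obtain ⟨X, hX⟩ : ∃ X : ℝ → ℝ, ∀ τ, X τ = ∫ x, (1 + Q τ x) ^ (-b) * G τ x := ⟨_, fun _ => rfl⟩
  obtain ⟨Z, hZ⟩ : ∃ Z : ℝ → ℝ, ∀ τ, Z τ = ∫ x, (1 + Q τ x) := ⟨_, fun _ => rfl⟩
  obtain ⟨F, hF⟩ : ∃ F : ℝ → ℝ, ∀ τ, F τ = ∫ x, G τ x ^ a := ⟨_, fun _ => rfl⟩
  have hus : ∀ τ ∈ Icc 0 T, Torus.IsSmooth (u τ) := fun τ hτ => h.smooth_velocity.isSmooth_slice hτ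
  have hG0 : ∀ τ x, 0 ≤ G τ x := fun τ x => by
    rw [hG]; exact Finset.sum_nonneg fun k _ =>
      Finset.sum_nonneg fun i _ => Finset.sum_nonneg fun j _ => sq_nonneg _
  have hQ0 : ∀ τ x, 0 ≤ Q τ x := fun τ x => by rw [hQ]; exact torusVorticitySqAt_nonneg _ _
  have hA : ∀ τ x, 0 < 1 + Q τ x := fun τ x => by linarith [hQ0 τ x]
  -- continuity of slices
  have cG : ∀ τ ∈ Icc 0 T, Continuous (G τ) := fun τ hτ => by
    rw [show G τ = fun x => ∑ k, ∑ i, ∑ j,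
      Torus.partialDeriv k (torusVorticityTensor (u τ) i j) x ^ 2 from funext (hG τ)]
    exact continuous_finsetSum _ fun k _ => continuous_finsetSum _ fun i _ =>
      continuous_finsetSum _ fun j _ => ((isSmooth_W₉ (hus τ hτ) i j).partialDeriv k).continuous.pow 2
  have cQ : ∀ τ ∈ Icc 0 T, Continuous (Q τ) := fun τ hτ => by
    rw [show Q τ = torusVorticitySqAt (u τ) from funext (hQ τ)]
    exact (isSmooth_Q₉ (hus τ hτ)).continuous
  -- Step 1: Hölder in `x`: `F ≤ X^a Z^{1-a}` on `[0, T]`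
  have hstep : ∀ τ ∈ Icc 0 T, F τ ≤ X τ ^ a * Z τ ^ (1 - a) := by
    intro τ hτ
    have cf : Continuous fun x => ((1 + Q τ x) ^ (-b) * G τ x) ^ a :=
      (((continuous_const.add (cQ τ hτ)).rpow_const fun x => Or.inl (hA τ x).ne').mul
        (cG τ hτ)).rpow_const fun x => Or.inr ha0.le
    have cg : Continuous fun x => (1 + Q τ x) ^ (a * b) :=
      (continuous_const.add (cQ τ hτ)).rpow_const fun x => Or.inl (hA τ x).ne'
    have hf0 : ∀ x, 0 ≤ ((1 + Q τ x) ^ (-b) * G τ x) ^ a := fun x =>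
      Real.rpow_nonneg (mul_nonneg (Real.rpow_nonneg (hA τ x).le _) (hG0 τ x)) _
    have hg0 : ∀ x, 0 ≤ (1 + Q τ x) ^ (a * b) := fun x => Real.rpow_nonneg (hA τ x).le _
    have hH := integral_mul_le_rpow₉ cf cg hf0 hg0 hpq
    -- identify the three integrands
    have e1 : ∀ x, ((1 + Q τ x) ^ (-b) * G τ x) ^ a * (1 + Q τ x) ^ (a * b) = G τ x ^ a := by
      intro x
      rw [Real.mul_rpow (Real.rpow_nonneg (hA τ x).le _) (hG0 τ x), ← Real.rpow_mul (hA τ x).le]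
      have : (1 + Q τ x) ^ (-b * a) * (1 + Q τ x) ^ (a * b) = 1 := by
        rw [← Real.rpow_add (hA τ x), show -b * a + a * b = 0 by ring, Real.rpow_zero]
      calc (1 + Q τ x) ^ (-b * a) * G τ x ^ a * (1 + Q τ x) ^ (a * b)
          = (1 + Q τ x) ^ (-b * a) * (1 + Q τ x) ^ (a * b) * G τ x ^ a := by ring
        _ = G τ x ^ a := by rw [this, one_mul]
    have e2 : ∀ x, (((1 + Q τ x) ^ (-b) * G τ x) ^ a) ^ (1 / a) = (1 + Q τ x) ^ (-b) * G τ x := by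
      intro x
      rw [← Real.rpow_mul (mul_nonneg (Real.rpow_nonneg (hA τ x).le _) (hG0 τ x)),
        mul_one_div_cancel ha0.ne', Real.rpow_one]
    have e3 : ∀ x, ((1 + Q τ x) ^ (a * b)) ^ (1 / (1 - a)) = 1 + Q τ x := by
      intro x
      rw [← Real.rpow_mul (hA τ x).le, hab, ← h1a, mul_one_div_cancel (by linarith), Real.rpow_one]
    rw [hF, hX, hZ]
    calc (∫ x, G τ x ^ a) = ∫ x, ((1 + Q τ x) ^ (-b) * G τ x) ^ a * (1 + Q τ x) ^ (a * b) :=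
          integral_congr_ae (ae_of_all _ fun x => (e1 x).symm)
      _ ≤ (∫ x, (((1 + Q τ x) ^ (-b) * G τ x) ^ a) ^ (1 / a)) ^ (1 / (1 / a)) *
            (∫ x, ((1 + Q τ x) ^ (a * b)) ^ (1 / (1 - a))) ^ (1 / (1 / (1 - a))) := hH
      _ = (∫ x, (1 + Q τ x) ^ (-b) * G τ x) ^ a * (∫ x, (1 + Q τ x)) ^ (1 - a) := by
          rw [one_div_one_div, one_div_one_div]
          congr 1
          · exact congrArg (fun r : ℝ => r ^ a) (integral_congr_ae (ae_of_all _ fun x => e2 x))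
          · exact congrArg (fun r : ℝ => r ^ (1 - a)) (integral_congr_ae (ae_of_all _ fun x => e3 x))
  -- Step 2: continuity in `t` of `F`, `X`, `Z`
  have hU : UniqueDiffOn ℝ (Icc 0 T) := uniqueDiffOn_Icc hT
  have hQst := isSmoothSpaceTimeOn_Q₉ h.smooth_velocity hT
  have hWst := fun i j => isSmoothSpaceTimeOn_W₉ h.smooth_velocity hT i j
  have cQst : ContinuousOn (Torus.stLift (fun s y => torusVorticitySqAt (u s) y)) (Icc 0 T ×ˢ univ) :=
    hQst.continuousOn_stLift
  have cGst : ContinuousOn (Torus.stLift G) (Icc 0 T ×ˢ univ) := by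
    have e' : Torus.stLift G = fun z => ∑ k, ∑ i, ∑ j, Torus.stLift (fun s y =>
        Torus.partialDeriv k (torusVorticityTensor (u s) i j) y) z ^ 2 := by
      funext z; simp only [Torus.stLift, hG]
    rw [e']
    exact continuousOn_finsetSum _ fun k _ => continuousOn_finsetSum _ fun i _ =>
      continuousOn_finsetSum _ fun j _ => (((hWst i j).partialDeriv hU k).continuousOn_stLift).pow 2
  have hFc : ContinuousOn F (Icc 0 T) := by
    rw [show F = fun τ => ∫ x, G τ x ^ a from funext hF]
    refine continuousOn_integral_of_continuousOn_stLift₉ (φ := fun τ x => G τ x ^ a) ?_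
      fun τ hτ => (cG τ hτ).rpow_const fun x => Or.inr ha0.le
    have e' : Torus.stLift (fun τ x => G τ x ^ a) = fun z => Torus.stLift G z ^ a := rfl
    rw [e']
    exact cGst.rpow_const fun z hz => Or.inr ha0.le
  have hXc : ContinuousOn X (Icc 0 T) := by
    rw [show X = fun τ => ∫ x, (1 + Q τ x) ^ (-b) * G τ x from funext hX]
    have hXc' := continuousOn_integral_of_continuousOn_stLift₉
      (continuousOn_stLift_weightedGradSq₉ hT h.smooth_velocity (-b))
      fun τ hτ => continuous_weightedGradSq₉ (hus τ hτ) (-b)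
    refine hXc'.congr fun τ _ => ?_
    simp only [hQ, hG]
  have hZc : ContinuousOn Z (Icc 0 T) := by
    rw [show Z = fun τ => ∫ x, (1 + Q τ x) from funext hZ]
    refine continuousOn_integral_of_continuousOn_stLift₉ (φ := fun τ x => 1 + Q τ x) ?_
      fun τ hτ => continuous_const.add (cQ τ hτ)
    have e' : Torus.stLift (fun τ x => 1 + Q τ x) =
        fun z => 1 + Torus.stLift (fun s y => torusVorticitySqAt (u s) y) z := by
      funext z; simp only [Torus.stLift, hQ]
    rw [e']
    exact continuousOn_const.add cQst
  have hX0 : ∀ τ ∈ Icc 0 T, 0 ≤ X τ := fun τ hτ => by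
    rw [hX]; exact integral_nonneg fun x => mul_nonneg (Real.rpow_nonneg (hA τ x).le _) (hG0 τ x)
  have hZ0 : ∀ τ ∈ Icc 0 T, 0 ≤ Z τ := fun τ hτ => by
    rw [hZ]; exact integral_nonneg fun x => (hA τ x).le
  -- Step 3: Hölder in `t`
  have huIcc : uIcc 0 T = Icc 0 T := uIcc_of_le hT.le
  have hFi : IntervalIntegrable F volume 0 T := (hFc.mono (by rw [huIcc])).intervalIntegrable
  have hPi : IntervalIntegrable (fun τ => X τ ^ a * Z τ ^ (1 - a)) volume 0 T := by
    refine (ContinuousOn.mono ?_ (by rw [huIcc])).intervalIntegrable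
    exact (hXc.rpow_const fun τ hτ => Or.inr ha0.le).mul (hZc.rpow_const fun τ hτ => Or.inr (by linarith))
  have hI1 : (∫ τ in (0 : ℝ)..T, F τ) ≤ ∫ τ in (0 : ℝ)..T, X τ ^ a * Z τ ^ (1 - a) :=
    intervalIntegral.integral_mono_on hT.le hFi hPi fun τ hτ => hstep τ hτ
  have hI2 : (∫ τ in (0 : ℝ)..T, X τ ^ a * Z τ ^ (1 - a)) ≤
      (∫ τ in (0 : ℝ)..T, X τ) ^ a * (∫ τ in (0 : ℝ)..T, Z τ) ^ (1 - a) := by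
    have h1a0 : 0 ≤ 1 - a := by linarith
    have hH := intervalIntegral_mul_le_rpow₉ hT.le (hXc.rpow_const (p := a) fun τ hτ => Or.inr ha0.le)
      (hZc.rpow_const (p := 1 - a) fun τ hτ => Or.inr h1a0)
      (fun τ hτ => Real.rpow_nonneg (hX0 τ hτ) _) (fun τ hτ => Real.rpow_nonneg (hZ0 τ hτ) _) hpq
    rw [one_div_one_div, one_div_one_div] at hH
    have eX : (∫ τ in (0 : ℝ)..T, (X τ ^ a) ^ (1 / a)) = ∫ τ in (0 : ℝ)..T, X τ := by
      refine intervalIntegral.integral_congr fun τ hτ => ?_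
      rw [huIcc] at hτ
      show (X τ ^ a) ^ (1 / a) = X τ
      rw [← Real.rpow_mul (hX0 τ hτ), mul_one_div_cancel ha0.ne', Real.rpow_one]
    have eZ : (∫ τ in (0 : ℝ)..T, (Z τ ^ (1 - a)) ^ (1 / (1 - a))) = ∫ τ in (0 : ℝ)..T, Z τ := by
      refine intervalIntegral.integral_congr fun τ hτ => ?_
      rw [huIcc] at hτ
      show (Z τ ^ (1 - a)) ^ (1 / (1 - a)) = Z τ
      rw [← Real.rpow_mul (hZ0 τ hτ), mul_one_div_cancel (by linarith), Real.rpow_one]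
    rwa [eX, eZ] at hH
  -- Step 4: the two budgets
  set M : ℝ := 1 + 1 / (2 * (1 - ε)) + (∫ x, torusVorticitySqAt (u 0) x ^ ((1 : ℝ) / 2)) +
    (∫ x, ‖u 0 x‖ ^ 2) / (2 * ν) with hM
  have hXI : (∫ τ in (0 : ℝ)..T, X τ) ≤ 4 * M / (ν * ε) := by
    have hw := Torus.classicalNS_integral_weightedVorticityGradSq_le hd hν hT h hε hε1
    have e : (fun t => ∫ x, (1 + torusVorticitySqAt (u t) x) ^ ((1 - ε) / 2 - 1) *
        ∑ k, ∑ i, ∑ j, Torus.partialDeriv k (torusVorticityTensor (u t) i j) x ^ 2) = X := by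
      funext t; rw [hX, hexp]; simp only [hQ, hG]
    rw [e] at hw
    rw [le_div_iff₀ (by positivity)]
    linarith
  have hZI : (∫ τ in (0 : ℝ)..T, Z τ) ≤ T + (∫ x, ‖u 0 x‖ ^ 2) / (2 * ν) := by
    have hg := Torus.classicalNS_integral_gradNormSq_le hν hT h
    have eZ : ∀ τ ∈ Icc 0 T, Z τ = 1 + Torus.gradNormSq (u τ) := fun τ hτ => by
      rw [hZ, integral_add (integrable_const _) (cQ τ hτ).integrable_unitAddTorus,
        show Q τ = torusVorticitySqAt (u τ) from funext (hQ τ),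
        integral_torusVorticitySqAt_eq_two_mul_torusEnstrophy (hus τ hτ) (h.divFree τ hτ),
        ← gradNormSq_eq_two_mul_torusEnstrophy]
      simp
    have hgc : ContinuousOn (fun τ => Torus.gradNormSq (u τ)) (Icc 0 T) := by
      intro t ht
      have h1 : ContinuousWithinAt (fun s => (2 : ℝ) * (2⁻¹ * Torus.gradNormSq (u s))) (Icc 0 T) t :=
        continuousWithinAt_const.mul (h.hasDerivWithinAt_half_gradNormSq hT ht).continuousWithinAt
      refine h1.congr (fun s _ => ?_) ?_ <;> ring
    have e : (∫ τ in (0 : ℝ)..T, Z τ) = ∫ τ in (0 : ℝ)..T, (1 + Torus.gradNormSq (u τ)) :=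
      intervalIntegral.integral_congr fun τ hτ => eZ τ (by rwa [huIcc] at hτ)
    rw [e, intervalIntegral.integral_add intervalIntegrable_const
      ((hgc.mono (by rw [huIcc])).intervalIntegrable), intervalIntegral.integral_const, smul_eq_mul,
      sub_zero, mul_one]
    linarith
  have hXI0 : 0 ≤ ∫ τ in (0 : ℝ)..T, X τ := intervalIntegral.integral_nonneg hT.le hX0
  have hZI0 : 0 ≤ ∫ τ in (0 : ℝ)..T, Z τ := intervalIntegral.integral_nonneg hT.le hZ0
  -- conclusion
  have eF : (fun t => ∫ x, (∑ k, ∑ i, ∑ j,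
      Torus.partialDeriv k (torusVorticityTensor (u t) i j) x ^ 2) ^ (2 / (3 + ε))) = F := by
    funext t; rw [hF, ha]; simp only [hG]
  rw [eF, ← h1a]
  calc (∫ τ in (0 : ℝ)..T, F τ) ≤ (∫ τ in (0 : ℝ)..T, X τ) ^ a * (∫ τ in (0 : ℝ)..T, Z τ) ^ (1 - a) :=
        hI1.trans hI2
    _ ≤ (4 * M / (ν * ε)) ^ a * (T + (∫ x, ‖u 0 x‖ ^ 2) / (2 * ν)) ^ (1 - a) :=
        mul_le_mul (Real.rpow_le_rpow hXI0 hXI ha0.le) (Real.rpow_le_rpow hZI0 hZI (by linarith))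
          (Real.rpow_nonneg hZI0 _) (Real.rpow_nonneg (hXI0.trans hXI) _)

end Literature.Analysis.FluidPDE

end
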